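import Literature.Geometry.Riemannian.LinearHeatWeakRegularity
import Literature.Analysis.PDE.LionsProjectionLemma
import Literature.Geometry.Riemannian.ShiDerivativeMaxPrinciple
import Mathlib.MeasureTheory.Integral.IntegralEqImproper
import Mathlib.Analysis.Distribution.AEEqOfIntegralContDiff
import HarnessLib

/-!
# Very weak solutions of the linear heat equation on a closed manifold (Lions' method)

Third step of the solvability of the linear heat-type Cauchy problem
`∂ₛw = Δ_{h(s)}w − Qw` on a closed manifold (hypothesis `hLP` of
`perelman_noLocalCollapsing_of_linearHeat`; discharge of the named fact
`Literature.Geometry.Riemannian.perelman_noLocalCollapsing`, Perelman 2002, Thm. 4.1): the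
EXISTENCE of a very weak `L²` solution by J.-L. Lions' projection lemma, exactly as in
F. Trèves, *Basic Linear Partial Differential Equations* (1975), §41 (proof of Thm. 40.1 — the
mixed problem for the heat equation — from Lemma 41.2 after the exponential shift (41.9)), here
for the operator `∂ₛ − Δ_{h(s)} + Q` of a smooth family of Riemannian metrics on a closed
manifold, in the space-time `L²` space of the reference measure `dV_{g₀} ⊗ ds`
(`ρ = dV_{h(s)}/dV_{g₀}`, `MetricDensityRatio.lean`). With `𝒜ζ = −∂ₛ(ρζ) − ρΔ_{h(s)}ζ + ρQζ`
(the formal adjoint of `ρ(∂ₛ − Δ + Q)` for `dV_{g₀} ⊗ ds`):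

* `integral_densityRatio_mul_mul_laplaceBeltrami` (`_comm`, `_self_nonpos`) — Green's identity
  with the density, `∫ ρ u Δ_{h(s)}w dV_{g₀} = −∫ h⁻¹(du, dw) dV_{h(s)}`;
* `integral_mul_heatAdjoint_eq` — **the space-time Green identity**
  `∫ v 𝒜ζ = ∫ ρ(∂ₛv − Δv + Qv) ζ` for smooth `v` and compactly supported smooth `ζ`
  (integration by parts in time, Green in space, Fubini);
* `energy_le_integral_mul_heatAdjoint` — **the energy inequality** (Trèves (41.7)):
  under the coercivity condition `ρ + ½∂ₛρ ≤ ρQ` on `M × [a, b]`,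
  `∫_{M×(a,b)} ρφ² ≤ ∫_{M×(a,b)} φ 𝒜φ` for smooth `φ` vanishing at `s = b`;
* **`exists_veryWeak_linearHeat`** — Lions' lemma (`lions_projection`,
  `LionsProjectionLemma.lean`) in `H = L²(M × (a, b))` with the test space of smooth functions
  vanishing near `s = b` gives a measurable `u ∈ L²`, zero off `M × (a, b)`, with
  `∫ u 𝒜ζ = ∫_{M×(a,b)} ρGζ` for all smooth `ζ` compactly supported in `M × (−∞, b)` (a very
  weak solution of `∂ₛu = Δ_{h(s)}u − Qu + G` with zero initial data at `s = a`, extended by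
  zero);
* **`linearHeat_eq_of_smooth_veryWeak`** — a very weak solution which is `C^∞` on the open strip
  solves `∂ₛv = Δ_{h(s)}v − Qv + G` there classically (time cut-off, the space-time Green
  identity and the fundamental lemma of the calculus of variations on `M × ℝ`, Mathlib's
  `IsOpen.ae_eq_zero_of_integral_contMDiff_smul_eq_zero`; Trèves (41.20)–(41.21)).

Everything is proved; no definitions, no named facts.

## References

* F. Trèves, *Basic Linear Partial Differential Equations*, Academic Press 1975, §41:
  Lemma 41.2, (41.7), (41.9), (41.19)–(41.21), Thm. 40.1. [Treves1975]
* P. Topping, *Lectures on the Ricci flow* (2006), Rem. 8.2.5 with §6.4 (the linear parabolic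
  equation behind Perelman's monotonicity). [Topping2006]
* I. Chavel, *Riemannian Geometry: A Modern Introduction*, 2nd ed., CUP 2006, §III.7.
  [Chavel2006]
-/

noncomputable section

open Bundle Set Function Filter Manifold MeasureTheory Measure TopologicalSpace intervalIntegral
open scoped Manifold ContDiff Topology ENNReal InnerProductSpace

namespace Literature.Geometry.Riemannian

open Lorentzian Lorentzian.PseudoRiemannianMetric Literature.Analysis.PDE

variable {m : ℕ} {H : Type*} [TopologicalSpace H]
  {I : ModelWithCorners ℝ (EuclideanSpace ℝ (Fin m)) H} [I.Boundaryless]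
  {M : Type*} [TopologicalSpace M] [ChartedSpace H M] [IsManifold I ∞ M]
  [T2Space M] [CompactSpace M] [MeasurableSpace M] [BorelSpace M]
  {h : ℝ → PseudoRiemannianMetric I ∞ (EuclideanSpace ℝ (Fin m)) (TangentSpace I : M → Type _)}
  {g₀ : PseudoRiemannianMetric I ∞ (EuclideanSpace ℝ (Fin m)) (TangentSpace I : M → Type _)}

/-! ### Green's identity with the density ratio, at a fixed time -/

section Green

/-- **Green's identity with density**: `∫ ρ(s) u Δ_{h(s)} w dV_{g₀} = −∫ h(s)⁻¹(du, dw) dV_{h(s)}`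
for `C¹` `u` and `C²` `w` on the closed manifold (`dV_{h(s)} = ρ(s) dV_{g₀}`,
`integral_riemVolume_eq_integral_mul_densityRatio`, and Green's identity
`integral_mul_dalembertian_eq_neg_integral_innerDual`). [cite: Chavel2006, §III.7] -/
theorem integral_densityRatio_mul_mul_laplaceBeltrami
    {g : PseudoRiemannianMetric I ∞ (EuclideanSpace ℝ (Fin m)) (TangentSpace I : M → Type _)}
    (hg : g.IsRiemannian) (hR₀ : g₀.IsRiemannian) {u w : M → ℝ}
    (hu : ContMDiff I 𝓘(ℝ, ℝ) 1 u) (hw : ContMDiff I 𝓘(ℝ, ℝ) 2 w) :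
    ∫ x, g.densityRatio g₀ x * (u x * g.laplaceBeltrami w x) ∂g₀.riemVolume =
      -∫ x, g.innerDual x (mvfderiv I u x).toLinearMap (mvfderiv I w x).toLinearMap ∂g.riemVolume := by
  haveI := (ofRiemannian (g.toContMDiffRiemannianMetric hg)).hasLeviCivita
  have h1 := integral_mul_dalembertian_eq_neg_integral_innerDual (g.toContMDiffRiemannianMetric hg)
    hu hw
  rw [← riemVolume_eq hg] at h1
  have h2 : ∫ x, u x * g.laplaceBeltrami w x ∂g.riemVolume =
      ∫ x, g.densityRatio g₀ x * (u x * g.laplaceBeltrami w x) ∂g₀.riemVolume := by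
    rw [integral_riemVolume_eq_integral_mul_densityRatio hg hR₀]
    exact integral_congr_ae (Eventually.of_forall fun x ↦ by ring)
  rw [← h2]
  exact h1

/-- `∫ ρ(s) u Δ_{h(s)} w dV_{g₀}` is symmetric in `u, w ∈ C²`. [cite: Chavel2006, §III.7] -/
theorem integral_densityRatio_mul_mul_laplaceBeltrami_comm
    {g : PseudoRiemannianMetric I ∞ (EuclideanSpace ℝ (Fin m)) (TangentSpace I : M → Type _)}
    (hg : g.IsRiemannian) (hR₀ : g₀.IsRiemannian) {u w : M → ℝ}
    (hu : ContMDiff I 𝓘(ℝ, ℝ) 2 u) (hw : ContMDiff I 𝓘(ℝ, ℝ) 2 w) :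
    ∫ x, g.densityRatio g₀ x * (u x * g.laplaceBeltrami w x) ∂g₀.riemVolume =
      ∫ x, g.densityRatio g₀ x * (w x * g.laplaceBeltrami u x) ∂g₀.riemVolume := by
  rw [integral_densityRatio_mul_mul_laplaceBeltrami hg hR₀ (hu.of_le (by norm_cast)) hw,
    integral_densityRatio_mul_mul_laplaceBeltrami hg hR₀ (hw.of_le (by norm_cast)) hu]
  congr 1
  exact integral_congr_ae (Eventually.of_forall fun x ↦ g.innerDual_comm x _ _)

/-- `∫ ρ(s) u Δ_{h(s)} u dV_{g₀} ≤ 0`. [cite: Chavel2006, §III.7] -/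
theorem integral_densityRatio_mul_mul_laplaceBeltrami_self_nonpos
    {g : PseudoRiemannianMetric I ∞ (EuclideanSpace ℝ (Fin m)) (TangentSpace I : M → Type _)}
    (hg : g.IsRiemannian) (hR₀ : g₀.IsRiemannian) {u : M → ℝ} (hu : ContMDiff I 𝓘(ℝ, ℝ) 2 u) :
    ∫ x, g.densityRatio g₀ x * (u x * g.laplaceBeltrami u x) ∂g₀.riemVolume ≤ 0 := by
  rw [integral_densityRatio_mul_mul_laplaceBeltrami hg hR₀ (hu.of_le (by norm_cast)) hu, neg_nonpos]
  refine integral_nonneg fun x ↦ ?_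
  have := innerDual_self_nonneg (g.toContMDiffRiemannianMetric hg) x (mvfderiv I u x).toLinearMap
  exact this

end Green

/-! ### Calculus of smooth functions on `M × ℝ`: slices and time derivatives -/

section SpaceTime

omit [I.Boundaryless] [IsManifold I ∞ M] [T2Space M] [CompactSpace M] [MeasurableSpace M]
  [BorelSpace M] in
/-- A space slice of a smooth function on `M × ℝ` is smooth. [folklore] -/
theorem contMDiff_slice_space {n : ℕ∞ω} {F : M × ℝ → ℝ}
    (hF : ContMDiff (I.prod 𝓘(ℝ, ℝ)) 𝓘(ℝ, ℝ) n F) (s : ℝ) :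
    ContMDiff I 𝓘(ℝ, ℝ) n fun x ↦ F (x, s) :=
  hF.comp (contMDiff_id.prodMk contMDiff_const)

omit [I.Boundaryless] [IsManifold I ∞ M] [T2Space M] [CompactSpace M] [MeasurableSpace M]
  [BorelSpace M] in
/-- A time slice of a smooth function on `M × ℝ` is smooth. [folklore] -/
theorem contDiff_slice_time {n : ℕ∞ω} {F : M × ℝ → ℝ}
    (hF : ContMDiff (I.prod 𝓘(ℝ, ℝ)) 𝓘(ℝ, ℝ) n F) (x : M) :
    ContDiff ℝ n fun s ↦ F (x, s) := by
  rw [← contMDiff_iff_contDiff]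
  exact hF.comp (contMDiff_const.prodMk contMDiff_id)

omit [T2Space M] [CompactSpace M] [MeasurableSpace M] [BorelSpace M] in
/-- The time derivative of a smooth function on `M × ℝ` is smooth on `M × ℝ`. [folklore] -/
theorem contMDiff_deriv_time {F : M × ℝ → ℝ} (hF : ContMDiff (I.prod 𝓘(ℝ, ℝ)) 𝓘(ℝ, ℝ) ∞ F) :
    ContMDiff (I.prod 𝓘(ℝ, ℝ)) 𝓘(ℝ, ℝ) ∞ fun p : M × ℝ ↦ deriv (fun s ↦ F (p.1, s)) p.2 := by
  have h1 := contMDiffOn_derivWithin_time_of_uniqueDiffOn (I := I) (M := M)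
    (u := fun s x ↦ F (x, s)) (S := univ) uniqueDiffOn_univ
    (by rw [univ_prod_univ]; exact hF.contMDiffOn)
  rw [univ_prod_univ] at h1
  simpa only [derivWithin_univ] using contMDiffOn_univ.1 h1

omit [I.Boundaryless] [IsManifold I ∞ M] [T2Space M] [CompactSpace M] [MeasurableSpace M]
  [BorelSpace M] in
/-- The time derivative of a smooth function on `M × ℝ` exists. [folklore] -/
theorem hasDerivAt_time {F : M × ℝ → ℝ} (hF : ContMDiff (I.prod 𝓘(ℝ, ℝ)) 𝓘(ℝ, ℝ) ∞ F)
    (x : M) (s : ℝ) : HasDerivAt (fun s' ↦ F (x, s')) (deriv (fun s' ↦ F (x, s')) s) s :=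
  (((contDiff_slice_time hF x).differentiable (by simp)) s).hasDerivAt

end SpaceTime

/-! ### The adjoint operator and the space-time identities -/

section Identities

variable (hh : IsContMDiffFamilyOn ∞ h univ) (hR : ∀ s, (h s).IsRiemannian)
  (hR₀ : g₀.IsRiemannian) {Q : ℝ → M → ℝ}
  (hQ : ContMDiff (I.prod 𝓘(ℝ, ℝ)) 𝓘(ℝ, ℝ) ∞ fun p : M × ℝ ↦ Q p.2 p.1)

include hh hR hR₀ in
omit [T2Space M] [CompactSpace M] [MeasurableSpace M] [BorelSpace M] in
/-- The density ratio `ρ(s, x) = dV_{h(s)}/dV_{g₀}` is smooth on `M × ℝ`. [folklore] -/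
theorem contMDiff_densityRatio_family :
    ContMDiff (I.prod 𝓘(ℝ, ℝ)) 𝓘(ℝ, ℝ) ∞ fun p : M × ℝ ↦ (h p.2).densityRatio g₀ p.1 := by
  have h1 := hh.contMDiffOn_densityRatio (fun s _ ↦ hR s) hR₀
  rw [univ_prod_univ] at h1
  exact contMDiffOn_univ.1 h1

include hh in
omit [T2Space M] [CompactSpace M] [MeasurableSpace M] [BorelSpace M] in
/-- The Laplacian of the slices of a smooth space-time function along the family is smooth on
`M × ℝ`. [folklore] -/
theorem contMDiff_laplaceBeltrami_family {ζ : M × ℝ → ℝ}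
    (hζ : ContMDiff (I.prod 𝓘(ℝ, ℝ)) 𝓘(ℝ, ℝ) ∞ ζ) :
    ContMDiff (I.prod 𝓘(ℝ, ℝ)) 𝓘(ℝ, ℝ) ∞
      fun p : M × ℝ ↦ (h p.2).laplaceBeltrami (fun x ↦ ζ (x, p.2)) p.1 := by
  have h1 := hh.contMDiffOn_laplaceBeltrami uniqueDiffOn_univ (f := fun s x ↦ ζ (x, s))
    (by rw [univ_prod_univ]; exact hζ.contMDiffOn)
  rw [univ_prod_univ] at h1
  exact contMDiffOn_univ.1 h1

include hh hR hR₀ hQ in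
omit [T2Space M] [CompactSpace M] [MeasurableSpace M] [BorelSpace M] in
/-- The adjoint expression `𝒜ζ = −∂ₛ(ρζ) − ρ Δ_{h(s)}ζ + ρQζ` is smooth on `M × ℝ` for smooth
`ζ`. [folklore] -/
theorem contMDiff_heatAdjoint {ζ : M × ℝ → ℝ} (hζ : ContMDiff (I.prod 𝓘(ℝ, ℝ)) 𝓘(ℝ, ℝ) ∞ ζ) :
    ContMDiff (I.prod 𝓘(ℝ, ℝ)) 𝓘(ℝ, ℝ) ∞ fun p : M × ℝ ↦
      -(deriv (fun s ↦ (h s).densityRatio g₀ p.1 * ζ (p.1, s)) p.2) -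
        (h p.2).densityRatio g₀ p.1 * (h p.2).laplaceBeltrami (fun x ↦ ζ (x, p.2)) p.1 +
        (h p.2).densityRatio g₀ p.1 * Q p.2 p.1 * ζ p := by
  have hρ := contMDiff_densityRatio_family hh hR hR₀
  have h1 : ContMDiff (I.prod 𝓘(ℝ, ℝ)) 𝓘(ℝ, ℝ) ∞
      fun p : M × ℝ ↦ deriv (fun s ↦ (h s).densityRatio g₀ p.1 * ζ (p.1, s)) p.2 :=
    contMDiff_deriv_time (F := fun p ↦ (h p.2).densityRatio g₀ p.1 * ζ p) (hρ.mul hζ)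
  exact (h1.neg.sub (hρ.mul (contMDiff_laplaceBeltrami_family hh hζ))).add ((hρ.mul hQ).mul hζ)

omit [I.Boundaryless] [T2Space M] [CompactSpace M] [MeasurableSpace M] [BorelSpace M] in
/-- The adjoint expression `𝒜ζ` vanishes off the support of `ζ`. [folklore] -/
theorem heatAdjoint_eq_zero_of_notMem_tsupport {ζ : M × ℝ → ℝ} {p : M × ℝ} (hp : p ∉ tsupport ζ) :
    -(deriv (fun s ↦ (h s).densityRatio g₀ p.1 * ζ (p.1, s)) p.2) -
        (h p.2).densityRatio g₀ p.1 * (h p.2).laplaceBeltrami (fun x ↦ ζ (x, p.2)) p.1 +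
        (h p.2).densityRatio g₀ p.1 * Q p.2 p.1 * ζ p = 0 := by
  obtain ⟨x, s⟩ := p
  have hev : ζ =ᶠ[𝓝 (x, s)] 0 := notMem_tsupport_iff_eventuallyEq.1 hp
  have hd : deriv (fun s' ↦ (h s').densityRatio g₀ x * ζ (x, s')) s = 0 := by
    have hc : ContinuousAt (fun s' : ℝ ↦ ((x, s') : M × ℝ)) s := by fun_prop
    have h1 : (fun s' ↦ (h s').densityRatio g₀ x * ζ (x, s')) =ᶠ[𝓝 s] fun _ ↦ 0 := by
      filter_upwards [hc.eventually hev] with s' hs'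
      rw [hs', Pi.zero_apply, mul_zero]
    rw [h1.deriv_eq]; exact deriv_const s 0
  have hslice : x ∉ tsupport (fun x' ↦ ζ (x', s)) := by
    intro hx
    have hc : ContinuousAt (fun x' : M ↦ ((x', s) : M × ℝ)) x := by fun_prop
    exact (notMem_tsupport_iff_eventuallyEq.2 (hc.eventually hev)) hx
  haveI := (h s).hasLeviCivita
  have hΔ0 : (h s).laplaceBeltrami (fun x' ↦ ζ (x', s)) x = 0 := by
    rw [laplaceBeltrami_eq_dalembertian]
    exact dalembertian_eq_zero_of_notMem_tsupport _ hslice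
  have hζ0 : ζ (x, s) = 0 := image_eq_zero_of_notMem_tsupport hp
  simp only [hd, hΔ0, hζ0, mul_zero, neg_zero, sub_zero, add_zero]

include hh hR hR₀ hQ in
/-- **The space-time Green identity**: for `v` smooth on `M × ℝ` and `ζ` smooth with compact
support,
`∫ v 𝒜ζ d(V_{g₀} ⊗ ds) = ∫ ρ (∂ₛv − Δ_{h(s)}v + Qv) ζ d(V_{g₀} ⊗ ds)`,
`𝒜ζ = −∂ₛ(ρζ) − ρΔζ + ρQζ` (integration by parts in time, Green's identity in space, Fubini).
[cite: Treves1975, §41, (41.20)–(41.21)] -/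
theorem integral_mul_heatAdjoint_eq {v ζ : M × ℝ → ℝ}
    (hv : ContMDiff (I.prod 𝓘(ℝ, ℝ)) 𝓘(ℝ, ℝ) ∞ v) (hζ : ContMDiff (I.prod 𝓘(ℝ, ℝ)) 𝓘(ℝ, ℝ) ∞ ζ)
    (hζc : HasCompactSupport ζ) :
    ∫ p, v p * (-(deriv (fun s ↦ (h s).densityRatio g₀ p.1 * ζ (p.1, s)) p.2) -
        (h p.2).densityRatio g₀ p.1 * (h p.2).laplaceBeltrami (fun x ↦ ζ (x, p.2)) p.1 +
        (h p.2).densityRatio g₀ p.1 * Q p.2 p.1 * ζ p) ∂g₀.riemVolume.prod (volume : Measure ℝ) =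
      ∫ p, (h p.2).densityRatio g₀ p.1 * (deriv (fun s ↦ v (p.1, s)) p.2 -
        (h p.2).laplaceBeltrami (fun x ↦ v (x, p.2)) p.1 + Q p.2 p.1 * v p) * ζ p
        ∂g₀.riemVolume.prod (volume : Measure ℝ) := by
  set μ₀ : Measure M := g₀.riemVolume with hμ₀
  haveI : IsFiniteMeasure μ₀ := by
    rw [hμ₀, riemVolume_eq hR₀]; exact isFiniteMeasure_riemannianMeasure _
  set ρ : M × ℝ → ℝ := fun p ↦ (h p.2).densityRatio g₀ p.1 with hρ
  have hρs : ContMDiff (I.prod 𝓘(ℝ, ℝ)) 𝓘(ℝ, ℝ) ∞ ρ := contMDiff_densityRatio_family hh hR hR₀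
  have hρζ : ContMDiff (I.prod 𝓘(ℝ, ℝ)) 𝓘(ℝ, ℝ) ∞ fun p ↦ ρ p * ζ p := hρs.mul hζ
  -- the three pieces of the left side and of the right side
  set A₁ : M × ℝ → ℝ := fun p ↦ deriv (fun s ↦ ρ (p.1, s) * ζ (p.1, s)) p.2 with hA₁
  set Δζ : M × ℝ → ℝ := fun p ↦ (h p.2).laplaceBeltrami (fun x ↦ ζ (x, p.2)) p.1 with hΔζ
  set Δv : M × ℝ → ℝ := fun p ↦ (h p.2).laplaceBeltrami (fun x ↦ v (x, p.2)) p.1 with hΔv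
  set vt : M × ℝ → ℝ := fun p ↦ deriv (fun s ↦ v (p.1, s)) p.2 with hvt
  have hA₁s : ContMDiff (I.prod 𝓘(ℝ, ℝ)) 𝓘(ℝ, ℝ) ∞ A₁ := contMDiff_deriv_time hρζ
  have hΔζs : ContMDiff (I.prod 𝓘(ℝ, ℝ)) 𝓘(ℝ, ℝ) ∞ Δζ := contMDiff_laplaceBeltrami_family hh hζ
  have hΔvs : ContMDiff (I.prod 𝓘(ℝ, ℝ)) 𝓘(ℝ, ℝ) ∞ Δv := contMDiff_laplaceBeltrami_family hh hv
  have hvts : ContMDiff (I.prod 𝓘(ℝ, ℝ)) 𝓘(ℝ, ℝ) ∞ vt := contMDiff_deriv_time hv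
  -- all integrands are continuous with compact support (inside `tsupport ζ`)
  have hK : IsCompact (tsupport ζ) := hζc
  have hζ0 : ∀ p ∉ tsupport ζ, ζ p = 0 := fun p hp ↦ image_eq_zero_of_notMem_tsupport hp
  have hslice0 : ∀ p : M × ℝ, p ∉ tsupport ζ → p.1 ∉ tsupport (fun x ↦ ζ (x, p.2)) := by
    rintro ⟨x, s⟩ hp hx
    have hev : ζ =ᶠ[𝓝 (x, s)] 0 := notMem_tsupport_iff_eventuallyEq.1 hp
    have hc : ContinuousAt (fun x' : M ↦ ((x', s) : M × ℝ)) x := by fun_prop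
    exact (notMem_tsupport_iff_eventuallyEq.2 (hc.eventually hev)) hx
  have hA₁0 : ∀ p ∉ tsupport ζ, A₁ p = 0 := by
    rintro ⟨x, s⟩ hp
    have hev : ζ =ᶠ[𝓝 (x, s)] 0 := notMem_tsupport_iff_eventuallyEq.1 hp
    have hc : ContinuousAt (fun s' : ℝ ↦ ((x, s') : M × ℝ)) s := by fun_prop
    have h1 : (fun s' ↦ ρ (x, s') * ζ (x, s')) =ᶠ[𝓝 s] fun _ ↦ 0 := by
      filter_upwards [hc.eventually hev] with s' hs'
      rw [hs', Pi.zero_apply, mul_zero]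
    simp only [hA₁]
    rw [h1.deriv_eq]; exact deriv_const s 0
  have hΔζ0 : ∀ p ∉ tsupport ζ, Δζ p = 0 := by
    rintro ⟨x, s⟩ hp
    haveI := (h s).hasLeviCivita
    simp only [hΔζ]
    rw [laplaceBeltrami_eq_dalembertian]
    exact dalembertian_eq_zero_of_notMem_tsupport _ (hslice0 (x, s) hp)
  -- integrability helper: continuous functions vanishing off `tsupport ζ`
  have hint : ∀ {F : M × ℝ → ℝ}, Continuous F → (∀ p ∉ tsupport ζ, F p = 0) →
      Integrable F (μ₀.prod (volume : Measure ℝ)) := fun hF hF0 ↦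
    hF.integrable_of_hasCompactSupport (HasCompactSupport.intro hK hF0)
  -- (1) the time term: `∫ v (−∂ₛ(ρζ)) = ∫ ρ ζ ∂ₛv`
  have htime : ∫ p, v p * (-A₁ p) ∂μ₀.prod (volume : Measure ℝ) =
      ∫ p, ρ p * vt p * ζ p ∂μ₀.prod (volume : Measure ℝ) := by
    have hi1 : Integrable (fun p ↦ v p * (-A₁ p)) (μ₀.prod (volume : Measure ℝ)) :=
      hint (hv.continuous.mul hA₁s.continuous.neg) fun p hp ↦ by rw [hA₁0 p hp, neg_zero, mul_zero]
    have hi2 : Integrable (fun p ↦ ρ p * vt p * ζ p) (μ₀.prod (volume : Measure ℝ)) :=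
      hint ((hρs.continuous.mul hvts.continuous).mul hζ.continuous)
        fun p hp ↦ by rw [hζ0 p hp, mul_zero]
    rw [integral_prod _ hi1, integral_prod _ hi2]
    refine integral_congr_ae (Eventually.of_forall fun x ↦ ?_)
    -- integration by parts on the line, at fixed `x`
    have hu : ∀ s, HasDerivAt (fun s' ↦ v (x, s')) (vt (x, s)) s := fun s ↦ hasDerivAt_time hv x s
    have hw : ∀ s, HasDerivAt (fun s' ↦ ρ (x, s') * ζ (x, s')) (A₁ (x, s)) s := fun s ↦
      hasDerivAt_time (F := fun p ↦ ρ p * ζ p) hρζ x s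
    have hKx : IsCompact (tsupport fun s' ↦ ρ (x, s') * ζ (x, s')) := by
      refine IsCompact.of_isClosed_subset (hK.image continuous_snd) (isClosed_tsupport _) ?_
      refine closure_minimal (fun s hs ↦ ?_) (hK.image continuous_snd).isClosed
      rw [mem_support] at hs
      have : (x, s) ∈ tsupport ζ := by
        by_contra h'; exact hs (by rw [hζ0 _ h', mul_zero])
      exact ⟨(x, s), this, rfl⟩
    have hcs : HasCompactSupport fun s' ↦ ρ (x, s') * ζ (x, s') := hKx
    have hcont1 : Continuous fun s' ↦ v (x, s') := (contDiff_slice_time hv x).continuous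
    have hcont2 : Continuous fun s' ↦ ρ (x, s') * ζ (x, s') :=
      (contDiff_slice_time (F := fun p ↦ ρ p * ζ p) hρζ x).continuous
    have hcont3 : Continuous fun s' ↦ A₁ (x, s') := (contDiff_slice_time hA₁s x).continuous
    have hcont4 : Continuous fun s' ↦ vt (x, s') := (contDiff_slice_time hvts x).continuous
    have hcsA : HasCompactSupport fun s' ↦ A₁ (x, s') := hcs.deriv.mono' (by
      intro s hs
      rw [mem_support] at hs
      change deriv (fun s' ↦ ρ (x, s') * ζ (x, s')) s ≠ 0 at hs
      exact subset_tsupport _ hs)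
    have hibp := integral_mul_deriv_eq_deriv_mul_of_integrable (u := fun s' ↦ v (x, s'))
      (v := fun s' ↦ ρ (x, s') * ζ (x, s')) (u' := fun s' ↦ vt (x, s')) (v' := fun s' ↦ A₁ (x, s'))
      (fun s _ ↦ hu s) (fun s _ ↦ hw s)
      ((hcont1.mul hcont3).integrable_of_hasCompactSupport hcsA.mul_left)
      ((hcont4.mul hcont2).integrable_of_hasCompactSupport hcs.mul_left)
      ((hcont1.mul hcont2).integrable_of_hasCompactSupport hcs.mul_left)
    calc ∫ s, v (x, s) * -A₁ (x, s) = -∫ s, v (x, s) * A₁ (x, s) := by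
          rw [← MeasureTheory.integral_neg]; exact integral_congr_ae (Eventually.of_forall fun s ↦ by ring)
      _ = ∫ s, vt (x, s) * (ρ (x, s) * ζ (x, s)) := by rw [hibp, neg_neg]
      _ = ∫ s, ρ (x, s) * vt (x, s) * ζ (x, s) :=
          integral_congr_ae (Eventually.of_forall fun s ↦ by ring)
  -- (2) the space term: `∫ v (−ρ Δζ) = ∫ −ρ (Δv) ζ`
  have hspace : ∫ p, v p * (-(ρ p * Δζ p)) ∂μ₀.prod (volume : Measure ℝ) =
      ∫ p, -(ρ p * Δv p * ζ p) ∂μ₀.prod (volume : Measure ℝ) := by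
    have hi1 : Integrable (fun p ↦ v p * (-(ρ p * Δζ p))) (μ₀.prod (volume : Measure ℝ)) :=
      hint (hv.continuous.mul (hρs.continuous.mul hΔζs.continuous).neg)
        fun p hp ↦ by rw [hΔζ0 p hp, mul_zero, neg_zero, mul_zero]
    have hi2 : Integrable (fun p ↦ -(ρ p * Δv p * ζ p)) (μ₀.prod (volume : Measure ℝ)) :=
      hint ((hρs.continuous.mul hΔvs.continuous).mul hζ.continuous).neg
        fun p hp ↦ by rw [hζ0 p hp, mul_zero, neg_zero]
    rw [integral_prod_symm _ hi1, integral_prod_symm _ hi2]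
    refine integral_congr_ae (Eventually.of_forall fun s ↦ ?_)
    have h2 : (2 : ℕ∞ω) ≤ ((⊤ : ℕ∞) : ℕ∞ω) := WithTop.coe_le_coe.mpr le_top
    have hsym := integral_densityRatio_mul_mul_laplaceBeltrami_comm (hR s) hR₀
      ((contMDiff_slice_space hv s).of_le h2) ((contMDiff_slice_space hζ s).of_le h2)
    calc ∫ x, v (x, s) * -(ρ (x, s) * Δζ (x, s)) ∂μ₀
        = -∫ x, (h s).densityRatio g₀ x * (v (x, s) *
            (h s).laplaceBeltrami (fun x ↦ ζ (x, s)) x) ∂μ₀ := by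
          rw [← MeasureTheory.integral_neg]
          exact integral_congr_ae (Eventually.of_forall fun x ↦ by simp only [hρ, hΔζ]; ring)
      _ = -∫ x, (h s).densityRatio g₀ x * (ζ (x, s) *
            (h s).laplaceBeltrami (fun x ↦ v (x, s)) x) ∂μ₀ := by rw [hsym]
      _ = ∫ x, -(ρ (x, s) * Δv (x, s) * ζ (x, s)) ∂μ₀ := by
          rw [← MeasureTheory.integral_neg]
          exact integral_congr_ae (Eventually.of_forall fun x ↦ by simp only [hρ, hΔv]; ring)
  -- (3) assemble
  have hi_t : Integrable (fun p ↦ v p * (-A₁ p)) (μ₀.prod (volume : Measure ℝ)) :=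
    hint (hv.continuous.mul hA₁s.continuous.neg) fun p hp ↦ by rw [hA₁0 p hp, neg_zero, mul_zero]
  have hi_s : Integrable (fun p ↦ v p * (-(ρ p * Δζ p))) (μ₀.prod (volume : Measure ℝ)) :=
    hint (hv.continuous.mul (hρs.continuous.mul hΔζs.continuous).neg)
      fun p hp ↦ by rw [hΔζ0 p hp, mul_zero, neg_zero, mul_zero]
  have hi_q : Integrable (fun p ↦ v p * (ρ p * Q p.2 p.1 * ζ p)) (μ₀.prod (volume : Measure ℝ)) :=
    hint (hv.continuous.mul ((hρs.continuous.mul hQ.continuous).mul hζ.continuous))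
      fun p hp ↦ by rw [hζ0 p hp, mul_zero, mul_zero]
  have hi_t' : Integrable (fun p ↦ ρ p * vt p * ζ p) (μ₀.prod (volume : Measure ℝ)) :=
    hint ((hρs.continuous.mul hvts.continuous).mul hζ.continuous) fun p hp ↦ by rw [hζ0 p hp, mul_zero]
  have hi_s' : Integrable (fun p ↦ -(ρ p * Δv p * ζ p)) (μ₀.prod (volume : Measure ℝ)) :=
    hint ((hρs.continuous.mul hΔvs.continuous).mul hζ.continuous).neg
      fun p hp ↦ by rw [hζ0 p hp, mul_zero, neg_zero]
  have hi_q' : Integrable (fun p ↦ ρ p * (Q p.2 p.1 * v p) * ζ p) (μ₀.prod (volume : Measure ℝ)) :=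
    hint ((hρs.continuous.mul (hQ.continuous.mul hv.continuous)).mul hζ.continuous)
      fun p hp ↦ by rw [hζ0 p hp, mul_zero]
  calc ∫ p, v p * (-(deriv (fun s ↦ (h s).densityRatio g₀ p.1 * ζ (p.1, s)) p.2) -
        (h p.2).densityRatio g₀ p.1 * (h p.2).laplaceBeltrami (fun x ↦ ζ (x, p.2)) p.1 +
        (h p.2).densityRatio g₀ p.1 * Q p.2 p.1 * ζ p) ∂μ₀.prod (volume : Measure ℝ)
      = ∫ p, (v p * (-A₁ p) + v p * (-(ρ p * Δζ p)) + v p * (ρ p * Q p.2 p.1 * ζ p))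
          ∂μ₀.prod (volume : Measure ℝ) :=
        integral_congr_ae (Eventually.of_forall fun p ↦ by simp only [hA₁, hρ, hΔζ]; ring)
    _ = (∫ p, v p * (-A₁ p) ∂μ₀.prod (volume : Measure ℝ)) +
          (∫ p, v p * (-(ρ p * Δζ p)) ∂μ₀.prod (volume : Measure ℝ)) +
          ∫ p, v p * (ρ p * Q p.2 p.1 * ζ p) ∂μ₀.prod (volume : Measure ℝ) := by
        have hi_ts : Integrable (fun p ↦ v p * (-A₁ p) + v p * (-(ρ p * Δζ p)))
            (μ₀.prod (volume : Measure ℝ)) := hi_t.add hi_s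
        have e1 : ∫ p, (v p * (-A₁ p) + v p * (-(ρ p * Δζ p)) + v p * (ρ p * Q p.2 p.1 * ζ p))
            ∂μ₀.prod (volume : Measure ℝ) =
            (∫ p, (v p * (-A₁ p) + v p * (-(ρ p * Δζ p))) ∂μ₀.prod (volume : Measure ℝ)) +
              ∫ p, v p * (ρ p * Q p.2 p.1 * ζ p) ∂μ₀.prod (volume : Measure ℝ) :=
          integral_add hi_ts hi_q
        have e2 : ∫ p, (v p * (-A₁ p) + v p * (-(ρ p * Δζ p))) ∂μ₀.prod (volume : Measure ℝ) =
            (∫ p, v p * (-A₁ p) ∂μ₀.prod (volume : Measure ℝ)) +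
              ∫ p, v p * (-(ρ p * Δζ p)) ∂μ₀.prod (volume : Measure ℝ) := integral_add hi_t hi_s
        rw [e1, e2]
    _ = (∫ p, ρ p * vt p * ζ p ∂μ₀.prod (volume : Measure ℝ)) +
          (∫ p, -(ρ p * Δv p * ζ p) ∂μ₀.prod (volume : Measure ℝ)) +
          ∫ p, ρ p * (Q p.2 p.1 * v p) * ζ p ∂μ₀.prod (volume : Measure ℝ) := by
        rw [htime, hspace]
        congr 1
        exact integral_congr_ae (Eventually.of_forall fun p ↦ by ring)
    _ = ∫ p, (ρ p * vt p * ζ p + -(ρ p * Δv p * ζ p) + ρ p * (Q p.2 p.1 * v p) * ζ p)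
          ∂μ₀.prod (volume : Measure ℝ) := by
        have hi_ts' : Integrable (fun p ↦ ρ p * vt p * ζ p + -(ρ p * Δv p * ζ p))
            (μ₀.prod (volume : Measure ℝ)) := hi_t'.add hi_s'
        have e1 : ∫ p, (ρ p * vt p * ζ p + -(ρ p * Δv p * ζ p) + ρ p * (Q p.2 p.1 * v p) * ζ p)
            ∂μ₀.prod (volume : Measure ℝ) =
            (∫ p, (ρ p * vt p * ζ p + -(ρ p * Δv p * ζ p)) ∂μ₀.prod (volume : Measure ℝ)) +
              ∫ p, ρ p * (Q p.2 p.1 * v p) * ζ p ∂μ₀.prod (volume : Measure ℝ) :=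
          integral_add hi_ts' hi_q'
        have e2 : ∫ p, (ρ p * vt p * ζ p + -(ρ p * Δv p * ζ p)) ∂μ₀.prod (volume : Measure ℝ) =
            (∫ p, ρ p * vt p * ζ p ∂μ₀.prod (volume : Measure ℝ)) +
              ∫ p, -(ρ p * Δv p * ζ p) ∂μ₀.prod (volume : Measure ℝ) := integral_add hi_t' hi_s'
        rw [e1, e2]
    _ = ∫ p, (h p.2).densityRatio g₀ p.1 * (deriv (fun s ↦ v (p.1, s)) p.2 -
          (h p.2).laplaceBeltrami (fun x ↦ v (x, p.2)) p.1 + Q p.2 p.1 * v p) * ζ p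
          ∂μ₀.prod (volume : Measure ℝ) :=
        integral_congr_ae (Eventually.of_forall fun p ↦ by simp only [hρ, hvt, hΔv]; ring)

end Identities

/-! ### Pointwise linearity of the adjoint expression -/

section Linearity

variable (hh : IsContMDiffFamilyOn ∞ h univ) (hR : ∀ s, (h s).IsRiemannian)
  (hR₀ : g₀.IsRiemannian) (Q : ℝ → M → ℝ)

omit [T2Space M] [CompactSpace M] [MeasurableSpace M] [BorelSpace M] in
/-- `Δ_g` of the sum of two `C²` slices. [folklore] -/
theorem laplaceBeltrami_slice_add (g : PseudoRiemannianMetric I ∞ (EuclideanSpace ℝ (Fin m))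
    (TangentSpace I : M → Type _)) {φ ψ : M × ℝ → ℝ}
    (hφ : ContMDiff (I.prod 𝓘(ℝ, ℝ)) 𝓘(ℝ, ℝ) ∞ φ) (hψ : ContMDiff (I.prod 𝓘(ℝ, ℝ)) 𝓘(ℝ, ℝ) ∞ ψ)
    (s : ℝ) (x : M) :
    g.laplaceBeltrami (fun y ↦ φ (y, s) + ψ (y, s)) x =
      g.laplaceBeltrami (fun y ↦ φ (y, s)) x + g.laplaceBeltrami (fun y ↦ ψ (y, s)) x := by
  haveI := g.hasLeviCivita
  have h2 : (2 : ℕ∞ω) ≤ ((⊤ : ℕ∞) : ℕ∞ω) := WithTop.coe_le_coe.mpr le_top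
  have h1 := dalembertian_add_const_mul (g := g) (p := x) 1
    (((contMDiff_slice_space hφ s).of_le h2) x) (((contMDiff_slice_space hψ s).of_le h2) x)
  simp only [one_mul] at h1
  simp only [laplaceBeltrami_eq_dalembertian]
  exact h1

omit [T2Space M] [CompactSpace M] [MeasurableSpace M] [BorelSpace M] in
/-- `Δ_g` of a constant multiple of a `C²` slice. [folklore] -/
theorem laplaceBeltrami_slice_smul (g : PseudoRiemannianMetric I ∞ (EuclideanSpace ℝ (Fin m))
    (TangentSpace I : M → Type _)) {φ : M × ℝ → ℝ}
    (hφ : ContMDiff (I.prod 𝓘(ℝ, ℝ)) 𝓘(ℝ, ℝ) ∞ φ) (c : ℝ) (s : ℝ) (x : M) :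
    g.laplaceBeltrami (fun y ↦ c * φ (y, s)) x = c * g.laplaceBeltrami (fun y ↦ φ (y, s)) x := by
  haveI := g.hasLeviCivita
  have h2 : (2 : ℕ∞ω) ≤ ((⊤ : ℕ∞) : ℕ∞ω) := WithTop.coe_le_coe.mpr le_top
  have h1 := dalembertian_add_const_mul (g := g) (p := x) (f₁ := fun _ ↦ (0 : ℝ)) c
    contMDiffAt_const (((contMDiff_slice_space hφ s).of_le h2) x)
  have h0 : g.dalembertian (fun _ : M ↦ (0 : ℝ)) x = 0 :=
    g.dalembertian_eq_zero_of_eventuallyEq_zero (Eventually.of_forall fun _ ↦ rfl)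
  simp only [zero_add, h0] at h1
  simp only [laplaceBeltrami_eq_dalembertian]
  exact h1

include hh hR hR₀ in
omit [T2Space M] [CompactSpace M] [MeasurableSpace M] [BorelSpace M] in
/-- The adjoint expression is additive in the test function. [folklore] -/
theorem heatAdjoint_add {φ ψ : M × ℝ → ℝ}
    (hφ : ContMDiff (I.prod 𝓘(ℝ, ℝ)) 𝓘(ℝ, ℝ) ∞ φ) (hψ : ContMDiff (I.prod 𝓘(ℝ, ℝ)) 𝓘(ℝ, ℝ) ∞ ψ)
    [T2Space M] (p : M × ℝ) :
    (-(deriv (fun s ↦ (h s).densityRatio g₀ p.1 * (φ (p.1, s) + ψ (p.1, s))) p.2) -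
        (h p.2).densityRatio g₀ p.1 *
          (h p.2).laplaceBeltrami (fun x ↦ φ (x, p.2) + ψ (x, p.2)) p.1 +
        (h p.2).densityRatio g₀ p.1 * Q p.2 p.1 * (φ p + ψ p)) =
      (-(deriv (fun s ↦ (h s).densityRatio g₀ p.1 * φ (p.1, s)) p.2) -
        (h p.2).densityRatio g₀ p.1 * (h p.2).laplaceBeltrami (fun x ↦ φ (x, p.2)) p.1 +
        (h p.2).densityRatio g₀ p.1 * Q p.2 p.1 * φ p) +
      (-(deriv (fun s ↦ (h s).densityRatio g₀ p.1 * ψ (p.1, s)) p.2) -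
        (h p.2).densityRatio g₀ p.1 * (h p.2).laplaceBeltrami (fun x ↦ ψ (x, p.2)) p.1 +
        (h p.2).densityRatio g₀ p.1 * Q p.2 p.1 * ψ p) := by
  have hρ := contMDiff_densityRatio_family hh hR hR₀
  have hd1 := hasDerivAt_time (F := fun q ↦ (h q.2).densityRatio g₀ q.1 * φ q) (hρ.mul hφ) p.1 p.2
  have hd2 := hasDerivAt_time (F := fun q ↦ (h q.2).densityRatio g₀ q.1 * ψ q) (hρ.mul hψ) p.1 p.2
  have hsum : (fun s ↦ (h s).densityRatio g₀ p.1 * (φ (p.1, s) + ψ (p.1, s))) =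
      fun s ↦ (h s).densityRatio g₀ p.1 * φ (p.1, s) + (h s).densityRatio g₀ p.1 * ψ (p.1, s) :=
    funext fun s ↦ by ring
  rw [hsum, deriv_fun_add hd1.differentiableAt hd2.differentiableAt, hd1.deriv, hd2.deriv,
    laplaceBeltrami_slice_add (h p.2) hφ hψ p.2 p.1]
  ring

include hh hR hR₀ in
omit [T2Space M] [CompactSpace M] [MeasurableSpace M] [BorelSpace M] in
/-- The adjoint expression is homogeneous in the test function. [folklore] -/
theorem heatAdjoint_smul {φ : M × ℝ → ℝ} (hφ : ContMDiff (I.prod 𝓘(ℝ, ℝ)) 𝓘(ℝ, ℝ) ∞ φ)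
    [T2Space M] (c : ℝ) (p : M × ℝ) :
    (-(deriv (fun s ↦ (h s).densityRatio g₀ p.1 * (c * φ (p.1, s))) p.2) -
        (h p.2).densityRatio g₀ p.1 * (h p.2).laplaceBeltrami (fun x ↦ c * φ (x, p.2)) p.1 +
        (h p.2).densityRatio g₀ p.1 * Q p.2 p.1 * (c * φ p)) =
      c * (-(deriv (fun s ↦ (h s).densityRatio g₀ p.1 * φ (p.1, s)) p.2) -
        (h p.2).densityRatio g₀ p.1 * (h p.2).laplaceBeltrami (fun x ↦ φ (x, p.2)) p.1 +
        (h p.2).densityRatio g₀ p.1 * Q p.2 p.1 * φ p) := by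
  have hρ := contMDiff_densityRatio_family hh hR hR₀
  have hd1 := hasDerivAt_time (F := fun q ↦ (h q.2).densityRatio g₀ q.1 * φ q) (hρ.mul hφ) p.1 p.2
  have hsmul : (fun s ↦ (h s).densityRatio g₀ p.1 * (c * φ (p.1, s))) =
      fun s ↦ c * ((h s).densityRatio g₀ p.1 * φ (p.1, s)) := funext fun s ↦ by ring
  rw [hsmul, (hd1.const_mul c).deriv, laplaceBeltrami_slice_smul (h p.2) hφ c p.2 p.1]
  ring

end Linearity

/-! ### The energy inequality -/

section Energy

variable (hh : IsContMDiffFamilyOn ∞ h univ) (hR : ∀ s, (h s).IsRiemannian)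
  (hR₀ : g₀.IsRiemannian) {Q : ℝ → M → ℝ}
  (hQ : ContMDiff (I.prod 𝓘(ℝ, ℝ)) 𝓘(ℝ, ℝ) ∞ fun p : M × ℝ ↦ Q p.2 p.1)

include hR₀ in
omit [I.Boundaryless] in
/-- Continuous functions on `M × ℝ` are integrable on the finite strips `M × (a, b)`. [folklore] -/
theorem integrableOn_strip_of_continuous {F : M × ℝ → ℝ} (hF : Continuous F) (a b : ℝ) :
    IntegrableOn F (univ ×ˢ Ioo a b) (g₀.riemVolume.prod (volume : Measure ℝ)) := by
  haveI : IsFiniteMeasure g₀.riemVolume := by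
    rw [riemVolume_eq hR₀]; exact isFiniteMeasure_riemannianMeasure _
  haveI : IsFiniteMeasureOnCompacts (g₀.riemVolume.prod (volume : Measure ℝ)) := by
    refine ⟨fun K hK ↦ ?_⟩
    obtain ⟨r, hr⟩ := (hK.image continuous_snd).isBounded.subset_closedBall 0
    calc (g₀.riemVolume.prod (volume : Measure ℝ)) K
        ≤ (g₀.riemVolume.prod (volume : Measure ℝ)) (univ ×ˢ Metric.closedBall (0 : ℝ) r) :=
          measure_mono fun p hp ↦ ⟨mem_univ _, hr ⟨p, hp, rfl⟩⟩
      _ = g₀.riemVolume univ * volume (Metric.closedBall (0 : ℝ) r) := Measure.prod_prod _ _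
      _ < ⊤ := ENNReal.mul_lt_top (measure_lt_top _ _) measure_closedBall_lt_top
  exact (hF.continuousOn.integrableOn_compact (isCompact_univ.prod isCompact_Icc)).mono_set
    (prod_mono le_rfl Ioo_subset_Icc_self)

include hh hR hR₀ hQ in
/-- **The energy inequality** (Trèves 1975, (41.7)): if `ρ + ½∂ₛρ ≤ ρQ` on `M × [a, b]`
(`ρ = dV_{h(s)}/dV_{g₀}`; arranged by an exponential shift of the unknown), then for every smooth
`φ` on `M × ℝ` vanishing for `s ≥ b`,
`∫_{M×(a,b)} ρ φ² ≤ ∫_{M×(a,b)} φ 𝒜φ`, `𝒜φ = −∂ₛ(ρφ) − ρΔ_{h(s)}φ + ρQφ`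
(`∫ φ(−∂ₛ(ρφ)) ds = ½ρφ²(a) − ½∫ ∂ₛρ φ²`, `−∫ ρφΔφ dV_{g₀} = ∫ |∇φ|² dV_{h(s)} ≥ 0`).
[cite: Treves1975, §41, (41.7) and Lemma 41.2] -/
theorem energy_le_integral_mul_heatAdjoint {a b : ℝ} (hab : a < b)
    (hcoer : ∀ (x : M), ∀ s ∈ Icc a b, (h s).densityRatio g₀ x +
      deriv (fun s ↦ (h s).densityRatio g₀ x) s / 2 ≤ (h s).densityRatio g₀ x * Q s x)
    {φ : M × ℝ → ℝ} (hφ : ContMDiff (I.prod 𝓘(ℝ, ℝ)) 𝓘(ℝ, ℝ) ∞ φ)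
    (hφb : ∀ x : M, ∀ s, b ≤ s → φ (x, s) = 0) :
    ∫ p in univ ×ˢ Ioo a b, (h p.2).densityRatio g₀ p.1 * φ p ^ 2
        ∂g₀.riemVolume.prod (volume : Measure ℝ) ≤
      ∫ p in univ ×ˢ Ioo a b, φ p * (-(deriv (fun s ↦ (h s).densityRatio g₀ p.1 * φ (p.1, s)) p.2) -
        (h p.2).densityRatio g₀ p.1 * (h p.2).laplaceBeltrami (fun x ↦ φ (x, p.2)) p.1 +
        (h p.2).densityRatio g₀ p.1 * Q p.2 p.1 * φ p) ∂g₀.riemVolume.prod (volume : Measure ℝ) := by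
  set μ₀ : Measure M := g₀.riemVolume with hμ₀
  haveI : IsFiniteMeasure μ₀ := by
    rw [hμ₀, riemVolume_eq hR₀]; exact isFiniteMeasure_riemannianMeasure _
  set ρ : M × ℝ → ℝ := fun p ↦ (h p.2).densityRatio g₀ p.1 with hρ
  set ρt : M × ℝ → ℝ := fun p ↦ deriv (fun s ↦ ρ (p.1, s)) p.2 with hρt
  set A₁ : M × ℝ → ℝ := fun p ↦ deriv (fun s ↦ ρ (p.1, s) * φ (p.1, s)) p.2 with hA₁
  set Δφ : M × ℝ → ℝ := fun p ↦ (h p.2).laplaceBeltrami (fun x ↦ φ (x, p.2)) p.1 with hΔφ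
  have hρs : ContMDiff (I.prod 𝓘(ℝ, ℝ)) 𝓘(ℝ, ℝ) ∞ ρ := contMDiff_densityRatio_family hh hR hR₀
  have hρts : ContMDiff (I.prod 𝓘(ℝ, ℝ)) 𝓘(ℝ, ℝ) ∞ ρt := contMDiff_deriv_time hρs
  have hρφ : ContMDiff (I.prod 𝓘(ℝ, ℝ)) 𝓘(ℝ, ℝ) ∞ fun p ↦ ρ p * φ p := hρs.mul hφ
  have hA₁s : ContMDiff (I.prod 𝓘(ℝ, ℝ)) 𝓘(ℝ, ℝ) ∞ A₁ := contMDiff_deriv_time hρφ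
  have hΔφs : ContMDiff (I.prod 𝓘(ℝ, ℝ)) 𝓘(ℝ, ℝ) ∞ Δφ := contMDiff_laplaceBeltrami_family hh hφ
  have hρpos : ∀ p, 0 < ρ p := fun p ↦ densityRatio_pos (hR p.2) hR₀ p.1
  -- the restricted product measure is a product
  set νt : Measure ℝ := (volume : Measure ℝ).restrict (Ioo a b) with hνt
  haveI : IsFiniteMeasure νt := ⟨by
    rw [hνt, Measure.restrict_apply_univ]; exact measure_Ioo_lt_top⟩
  have hπ : (μ₀.prod (volume : Measure ℝ)).restrict (univ ×ˢ Ioo a b) = μ₀.prod νt := by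
    rw [hνt, ← Measure.prod_restrict, Measure.restrict_univ]
  have hint : ∀ {F : M × ℝ → ℝ}, Continuous F → Integrable F (μ₀.prod νt) := fun hF ↦ by
    rw [← hπ]; exact integrableOn_strip_of_continuous hR₀ hF a b
  -- decomposition of the integrand
  have hdec : ∀ p, φ p * (-(deriv (fun s ↦ (h s).densityRatio g₀ p.1 * φ (p.1, s)) p.2) -
      (h p.2).densityRatio g₀ p.1 * (h p.2).laplaceBeltrami (fun x ↦ φ (x, p.2)) p.1 +
      (h p.2).densityRatio g₀ p.1 * Q p.2 p.1 * φ p) =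
      -(φ p * A₁ p) + -(ρ p * (φ p * Δφ p)) + ρ p * Q p.2 p.1 * φ p ^ 2 := by
    intro p; simp only [hA₁, hρ, hΔφ]; ring
  rw [hπ]
  simp_rw [hdec]
  have hi1 : Integrable (fun p ↦ -(φ p * A₁ p)) (μ₀.prod νt) := hint (hφ.continuous.mul hA₁s.continuous).neg
  have hi2 : Integrable (fun p ↦ -(ρ p * (φ p * Δφ p))) (μ₀.prod νt) :=
    hint (hρs.continuous.mul (hφ.continuous.mul hΔφs.continuous)).neg
  have hi3 : Integrable (fun p ↦ ρ p * Q p.2 p.1 * φ p ^ 2) (μ₀.prod νt) :=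
    hint ((hρs.continuous.mul hQ.continuous).mul (hφ.continuous.pow 2))
  have hi4 : Integrable (fun p ↦ ρt p * φ p ^ 2) (μ₀.prod νt) :=
    hint (hρts.continuous.mul (hφ.continuous.pow 2))
  have hi0 : Integrable (fun p ↦ ρ p * φ p ^ 2) (μ₀.prod νt) :=
    hint (hρs.continuous.mul (hφ.continuous.pow 2))
  -- (1) the time term: `∫ −φ ∂ₛ(ρφ) ≥ −½ ∫ ∂ₛρ φ²`
  have h1 : -(1 / 2) * ∫ p, ρt p * φ p ^ 2 ∂μ₀.prod νt ≤ ∫ p, -(φ p * A₁ p) ∂μ₀.prod νt := by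
    rw [integral_prod _ hi1, integral_prod _ hi4, ← MeasureTheory.integral_const_mul]
    refine integral_mono_ae ?_ ?_ (Eventually.of_forall fun x ↦ ?_)
    · exact (hi4.integral_prod_left.const_mul _)
    · exact hi1.integral_prod_left
    -- the one-dimensional identity at fixed `x`
    dsimp only
    have hρx : ∀ s, HasDerivAt (fun s' ↦ ρ (x, s')) (ρt (x, s)) s := fun s ↦ hasDerivAt_time hρs x s
    have hφx : ∀ s, HasDerivAt (fun s' ↦ φ (x, s')) (deriv (fun s' ↦ φ (x, s')) s) s :=
      fun s ↦ hasDerivAt_time hφ x s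
    have hA₁x : ∀ s, A₁ (x, s) = ρt (x, s) * φ (x, s) + ρ (x, s) * deriv (fun s' ↦ φ (x, s')) s := by
      intro s
      simp only [hA₁]
      rw [deriv_fun_mul (hρx s).differentiableAt (hφx s).differentiableAt, (hρx s).deriv]
    have c1 : Continuous fun s ↦ ρt (x, s) := (contDiff_slice_time hρts x).continuous
    have c2 : Continuous fun s ↦ φ (x, s) := (contDiff_slice_time hφ x).continuous
    have c3 : Continuous fun s ↦ ρ (x, s) := (contDiff_slice_time hρs x).continuous
    have c4 : Continuous fun s ↦ deriv (fun s' ↦ φ (x, s')) s :=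
      (contDiff_slice_time (contMDiff_deriv_time hφ) x).continuous
    -- `E(s) = ρ φ²`, `E' = ∂ₛρ φ² + 2ρφφ'`
    have hE : ∀ s, HasDerivAt (fun s' ↦ ρ (x, s') * φ (x, s') ^ 2)
        (ρt (x, s) * φ (x, s) ^ 2 + ρ (x, s) * (2 * φ (x, s) * deriv (fun s' ↦ φ (x, s')) s)) s := by
      intro s
      have hsq : (fun s' ↦ ρ (x, s') * φ (x, s') ^ 2) =
          fun s' ↦ ρ (x, s') * (φ (x, s') * φ (x, s')) := funext fun s' ↦ by ring
      rw [hsq]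
      exact ((hρx s).fun_mul ((hφx s).fun_mul (hφx s))).congr_deriv (by ring)
    have hcE : Continuous fun s ↦ ρt (x, s) * φ (x, s) ^ 2 + ρ (x, s) * (2 * φ (x, s) *
        deriv (fun s' ↦ φ (x, s')) s) :=
      (c1.mul (c2.pow 2)).add (c3.mul ((continuous_const.mul c2).mul c4))
    have hFTC : ∫ s in a..b, (ρt (x, s) * φ (x, s) ^ 2 + ρ (x, s) * (2 * φ (x, s) *
        deriv (fun s' ↦ φ (x, s')) s)) = 0 - ρ (x, a) * φ (x, a) ^ 2 := by
      rw [integral_eq_sub_of_hasDerivAt (fun s _ ↦ hE s) (hcE.intervalIntegrable a b),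
        hφb x b le_rfl]
      ring
    -- rewrite both sides as interval integrals
    have hI : ∀ (f : ℝ → ℝ), ∫ s, f s ∂νt = ∫ s in a..b, f s := fun f ↦ by
      rw [hνt, intervalIntegral.integral_of_le hab.le, integral_Ioc_eq_integral_Ioo]
    rw [hI, hI]
    have hlhs : ∫ s in a..b, -(φ (x, s) * A₁ (x, s)) =
        (1 / 2) * (ρ (x, a) * φ (x, a) ^ 2) - (1 / 2) * ∫ s in a..b, ρt (x, s) * φ (x, s) ^ 2 := by
      have heq : ∀ s, -(φ (x, s) * A₁ (x, s)) =
          -(1 / 2) * (ρt (x, s) * φ (x, s) ^ 2 + ρ (x, s) * (2 * φ (x, s) *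
            deriv (fun s' ↦ φ (x, s')) s)) + -(1 / 2) * (ρt (x, s) * φ (x, s) ^ 2) := by
        intro s; rw [hA₁x s]; ring
      simp_rw [heq]
      rw [intervalIntegral.integral_add, intervalIntegral.integral_const_mul,
        intervalIntegral.integral_const_mul, hFTC]
      · ring
      · exact ((hcE.const_smul (-(1 / 2) : ℝ)).intervalIntegrable a b).congr fun s _ ↦ by simp [smul_eq_mul]
      · exact (((c1.mul (c2.pow 2)).const_smul (-(1 / 2) : ℝ)).intervalIntegrable a b).congr
          fun s _ ↦ by simp [smul_eq_mul]
    rw [hlhs]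
    have hEa : 0 ≤ (1 / 2) * (ρ (x, a) * φ (x, a) ^ 2) := by
      have := hρpos (x, a); positivity
    linarith
  -- (2) the space term is nonnegative
  have h2 : 0 ≤ ∫ p, -(ρ p * (φ p * Δφ p)) ∂μ₀.prod νt := by
    rw [integral_prod_symm _ hi2]
    refine integral_nonneg fun s ↦ ?_
    change (0 : ℝ) ≤ ∫ x, -(ρ (x, s) * (φ (x, s) * Δφ (x, s))) ∂μ₀
    rw [MeasureTheory.integral_neg, neg_nonneg]
    have h2' : (2 : ℕ∞ω) ≤ ((⊤ : ℕ∞) : ℕ∞ω) := WithTop.coe_le_coe.mpr le_top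
    exact integral_densityRatio_mul_mul_laplaceBeltrami_self_nonpos (hR s) hR₀
      ((contMDiff_slice_space hφ s).of_le h2')
  -- (3) assemble with the coercivity assumption
  have hsum : ∫ p, -(φ p * A₁ p) + -(ρ p * (φ p * Δφ p)) + ρ p * Q p.2 p.1 * φ p ^ 2 ∂μ₀.prod νt =
      (∫ p, -(φ p * A₁ p) ∂μ₀.prod νt) + (∫ p, -(ρ p * (φ p * Δφ p)) ∂μ₀.prod νt) +
        ∫ p, ρ p * Q p.2 p.1 * φ p ^ 2 ∂μ₀.prod νt := by
    have hi12 : Integrable (fun p ↦ -(φ p * A₁ p) + -(ρ p * (φ p * Δφ p))) (μ₀.prod νt) := hi1.add hi2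
    have e1 : ∫ p, -(φ p * A₁ p) + -(ρ p * (φ p * Δφ p)) + ρ p * Q p.2 p.1 * φ p ^ 2 ∂μ₀.prod νt =
        (∫ p, -(φ p * A₁ p) + -(ρ p * (φ p * Δφ p)) ∂μ₀.prod νt) +
          ∫ p, ρ p * Q p.2 p.1 * φ p ^ 2 ∂μ₀.prod νt := integral_add hi12 hi3
    have e2 : ∫ p, -(φ p * A₁ p) + -(ρ p * (φ p * Δφ p)) ∂μ₀.prod νt =
        (∫ p, -(φ p * A₁ p) ∂μ₀.prod νt) + ∫ p, -(ρ p * (φ p * Δφ p)) ∂μ₀.prod νt :=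
      integral_add hi1 hi2
    rw [e1, e2]
  rw [hsum]
  -- `∫ ρφ² ≤ ∫ (ρQ − ½∂ₛρ) φ²`
  have hcoer' : ∫ p, ρ p * φ p ^ 2 ∂μ₀.prod νt ≤
      -(1 / 2) * (∫ p, ρt p * φ p ^ 2 ∂μ₀.prod νt) + ∫ p, ρ p * Q p.2 p.1 * φ p ^ 2 ∂μ₀.prod νt := by
    rw [← MeasureTheory.integral_const_mul, ← integral_add (hi4.const_mul _) hi3]
    refine integral_mono_ae hi0 ((hi4.const_mul _).add hi3) ?_
    have hmem : ∀ᵐ p ∂μ₀.prod νt, p ∈ univ ×ˢ Ioo a b := by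
      rw [← hπ]; exact ae_restrict_mem (MeasurableSet.univ.prod measurableSet_Ioo)
    filter_upwards [hmem] with p hp
    have hc := hcoer p.1 p.2 (Ioo_subset_Icc_self hp.2)
    simp only [hρ, hρt] at hc ⊢
    have hsq : 0 ≤ φ p ^ 2 := sq_nonneg _
    nlinarith
  linarith

end Energy

/-! ### `L²` tools on the strip -/

section L2Tools

variable {X : Type*} [MeasurableSpace X] {ν : Measure X}

/-- The `L²` norm of a real function: `‖f‖₂ = √(∫ f²)`. [folklore] -/
theorem norm_toLp_two_eq_sqrt {f : X → ℝ} (hf : MemLp f 2 ν) :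
    ‖hf.toLp f‖ = Real.sqrt (∫ x, f x ^ 2 ∂ν) := by
  rw [Lp.norm_toLp, hf.eLpNorm_eq_integral_rpow_norm two_ne_zero ENNReal.ofNat_ne_top,
    ENNReal.toReal_ofReal (by positivity), ENNReal.toReal_ofNat, Real.sqrt_eq_rpow]
  congr 1
  · refine integral_congr_ae (Eventually.of_forall fun x ↦ ?_)
    simp only [Real.norm_eq_abs]
    rw [show ((2 : ℝ)) = ((2 : ℕ) : ℝ) by norm_num, Real.rpow_natCast, sq_abs]
  · norm_num

/-- The `L²` inner product of two real functions is `∫ f g`. [folklore] -/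
theorem inner_toLp_toLp_eq_integral {f g : X → ℝ} (hf : MemLp f 2 ν) (hg : MemLp g 2 ν) :
    ⟪hf.toLp f, hg.toLp g⟫_ℝ = ∫ x, f x * g x ∂ν := by
  rw [L2.inner_def]
  refine integral_congr_ae ?_
  filter_upwards [hf.coeFn_toLp, hg.coeFn_toLp] with x hx hy
  rw [hx, hy, real_inner_comm, RCLike.inner_apply, conj_trivial]

/-- **Cauchy–Schwarz with a weight**: `|∫ ρ G φ| ≤ √(∫ ρG²) √(∫ ρφ²)` for `ρ ≥ 0`. [folklore] -/
theorem abs_integral_weight_mul_le {ρ G φ : X → ℝ} (hρ : ∀ x, 0 ≤ ρ x)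
    (h1 : MemLp (fun x ↦ Real.sqrt (ρ x) * G x) 2 ν) (h2 : MemLp (fun x ↦ Real.sqrt (ρ x) * φ x) 2 ν) :
    |∫ x, ρ x * G x * φ x ∂ν| ≤
      Real.sqrt (∫ x, ρ x * G x ^ 2 ∂ν) * Real.sqrt (∫ x, ρ x * φ x ^ 2 ∂ν) := by
  have hcs := abs_real_inner_le_norm (h1.toLp _) (h2.toLp _)
  rw [inner_toLp_toLp_eq_integral, norm_toLp_two_eq_sqrt, norm_toLp_two_eq_sqrt] at hcs
  have e0 : ∫ x, Real.sqrt (ρ x) * G x * (Real.sqrt (ρ x) * φ x) ∂ν = ∫ x, ρ x * G x * φ x ∂ν := by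
    refine integral_congr_ae (Eventually.of_forall fun x ↦ ?_)
    have := Real.mul_self_sqrt (hρ x)
    calc Real.sqrt (ρ x) * G x * (Real.sqrt (ρ x) * φ x)
        = (Real.sqrt (ρ x) * Real.sqrt (ρ x)) * G x * φ x := by ring
      _ = ρ x * G x * φ x := by rw [this]
  have e1 : ∫ x, (Real.sqrt (ρ x) * G x) ^ 2 ∂ν = ∫ x, ρ x * G x ^ 2 ∂ν :=
    integral_congr_ae (Eventually.of_forall fun x ↦ by dsimp only; rw [mul_pow, Real.sq_sqrt (hρ x)])
  have e2 : ∫ x, (Real.sqrt (ρ x) * φ x) ^ 2 ∂ν = ∫ x, ρ x * φ x ^ 2 ∂ν :=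
    integral_congr_ae (Eventually.of_forall fun x ↦ by dsimp only; rw [mul_pow, Real.sq_sqrt (hρ x)])
  rwa [e0, e1, e2] at hcs

end L2Tools

/-! ### Existence of a very weak `L²` solution (Lions' method) -/

section Existence

variable (hh : IsContMDiffFamilyOn ∞ h univ) (hR : ∀ s, (h s).IsRiemannian)
  (hR₀ : g₀.IsRiemannian) {Q G : ℝ → M → ℝ}
  (hQ : ContMDiff (I.prod 𝓘(ℝ, ℝ)) 𝓘(ℝ, ℝ) ∞ fun p : M × ℝ ↦ Q p.2 p.1)
  (hG : ContMDiff (I.prod 𝓘(ℝ, ℝ)) 𝓘(ℝ, ℝ) ∞ fun p : M × ℝ ↦ G p.2 p.1)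

include hh hR hR₀ hQ hG in
/-- **Existence of a very weak `L²` solution of the linear heat equation with zero initial data**
(Lions' method; Trèves 1975, §41, proof of Thm. 40.1 via Lemma 41.2). Let `h(s)` be a family of
Riemannian metrics `C^∞` on `M × ℝ` on the closed manifold `M`, `g₀` a Riemannian reference
metric, `ρ = dV_{h(s)}/dV_{g₀}`, `Q, G` smooth on `M × ℝ`, `a < b`, and assume the coercivity
condition `ρ + ½∂ₛρ ≤ ρQ` on `M × [a, b]`. Then there is a measurable `u ∈ L²(M × ℝ)`, vanishing
for `s ∉ (a, b)`, with
`∫ u 𝒜ζ d(V_{g₀} ⊗ ds) = ∫_{M×(a,b)} ρ G ζ d(V_{g₀} ⊗ ds)` for every smooth `ζ` with compact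
support in `M × (−∞, b)` (`𝒜ζ = −∂ₛ(ρζ) − ρΔ_{h(s)}ζ + ρQζ`): a very weak solution of
`∂ₛu = Δ_{h(s)}u − Qu + G` on `M × (a, b)` with `u(a) = 0` weakly (the test functions do not
vanish at `s = a`), extended by zero to `s ≤ a`. [cite: Treves1975, §41, Lemma 41.2 and Thm. 40.1] -/
theorem exists_veryWeak_linearHeat {a b : ℝ} (hab : a < b)
    (hcoer : ∀ (x : M), ∀ s ∈ Icc a b, (h s).densityRatio g₀ x +
      deriv (fun s ↦ (h s).densityRatio g₀ x) s / 2 ≤ (h s).densityRatio g₀ x * Q s x) :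
    ∃ u : M × ℝ → ℝ, Measurable u ∧ MemLp u 2 (g₀.riemVolume.prod (volume : Measure ℝ)) ∧
      (∀ p : M × ℝ, p.2 ∉ Ioo a b → u p = 0) ∧
      ∀ ζ : M × ℝ → ℝ, ContMDiff (I.prod 𝓘(ℝ, ℝ)) 𝓘(ℝ, ℝ) ∞ ζ → HasCompactSupport ζ →
        tsupport ζ ⊆ univ ×ˢ Iio b →
        ∫ p, u p * (-(deriv (fun s ↦ (h s).densityRatio g₀ p.1 * ζ (p.1, s)) p.2) -
            (h p.2).densityRatio g₀ p.1 * (h p.2).laplaceBeltrami (fun x ↦ ζ (x, p.2)) p.1 +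
            (h p.2).densityRatio g₀ p.1 * Q p.2 p.1 * ζ p) ∂g₀.riemVolume.prod (volume : Measure ℝ) =
          ∫ p in univ ×ˢ Ioo a b, (h p.2).densityRatio g₀ p.1 * G p.2 p.1 * ζ p
            ∂g₀.riemVolume.prod (volume : Measure ℝ) := by
  classical
  set μ₀ : Measure M := g₀.riemVolume with hμ₀
  haveI : IsFiniteMeasure μ₀ := by
    rw [hμ₀, riemVolume_eq hR₀]; exact isFiniteMeasure_riemannianMeasure _
  set S : Set (M × ℝ) := univ ×ˢ Ioo a b with hS
  have hSm : MeasurableSet S := MeasurableSet.univ.prod measurableSet_Ioo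
  set ν : Measure (M × ℝ) := (μ₀.prod (volume : Measure ℝ)).restrict S with hν
  haveI : IsFiniteMeasure ν := ⟨by
    rw [hν, Measure.restrict_apply_univ, hS, Measure.prod_prod]
    exact ENNReal.mul_lt_top (measure_lt_top _ _) measure_Ioo_lt_top⟩
  set ρ : M × ℝ → ℝ := fun p ↦ (h p.2).densityRatio g₀ p.1 with hρ
  have hρs : ContMDiff (I.prod 𝓘(ℝ, ℝ)) 𝓘(ℝ, ℝ) ∞ ρ := contMDiff_densityRatio_family hh hR hR₀
  have hρpos : ∀ p, 0 < ρ p := fun p ↦ densityRatio_pos (hR p.2) hR₀ p.1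
  -- the adjoint operator
  set A : (M × ℝ → ℝ) → (M × ℝ → ℝ) := fun φ p ↦
    -(deriv (fun s ↦ (h s).densityRatio g₀ p.1 * φ (p.1, s)) p.2) -
      (h p.2).densityRatio g₀ p.1 * (h p.2).laplaceBeltrami (fun x ↦ φ (x, p.2)) p.1 +
      (h p.2).densityRatio g₀ p.1 * Q p.2 p.1 * φ p with hA
  have hAs : ∀ {φ : M × ℝ → ℝ}, ContMDiff (I.prod 𝓘(ℝ, ℝ)) 𝓘(ℝ, ℝ) ∞ φ →
      ContMDiff (I.prod 𝓘(ℝ, ℝ)) 𝓘(ℝ, ℝ) ∞ (A φ) := fun hφ ↦ contMDiff_heatAdjoint hh hR hR₀ hQ hφ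
  -- continuous functions are in `L²(ν)` (bounded on the compact `M × [a, b]`)
  have hmemS : ∀ {F : M × ℝ → ℝ}, Continuous F → MemLp F 2 ν := by
    intro F hF
    obtain ⟨C, hC⟩ := (isCompact_univ.prod (isCompact_Icc (a := a) (b := b))).exists_bound_of_continuousOn
      hF.continuousOn
    refine MemLp.of_bound hF.aestronglyMeasurable C ?_
    rw [hν, ae_restrict_iff' hSm]
    exact Eventually.of_forall fun p hp ↦ hC p ⟨mem_univ _, Ioo_subset_Icc_self hp.2⟩
  -- the test space
  set Φ : Submodule ℝ (M × ℝ → ℝ) :=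
    { carrier := {φ | ContMDiff (I.prod 𝓘(ℝ, ℝ)) 𝓘(ℝ, ℝ) ∞ φ ∧
        ∃ b' < b, ∀ p : M × ℝ, b' ≤ p.2 → φ p = 0}
      add_mem' := by
        rintro φ ψ ⟨hφ, b₁, hb₁, h₁⟩ ⟨hψ, b₂, hb₂, h₂⟩
        refine ⟨hφ.add hψ, max b₁ b₂, max_lt hb₁ hb₂, fun p hp ↦ ?_⟩
        simp only [Pi.add_apply, h₁ p ((le_max_left _ _).trans hp), h₂ p ((le_max_right _ _).trans hp),
          add_zero]
      zero_mem' := ⟨contMDiff_const, b - 1, by linarith, fun p _ ↦ rfl⟩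
      smul_mem' := by
        rintro c φ ⟨hφ, b₁, hb₁, h₁⟩
        refine ⟨?_, b₁, hb₁, fun p hp ↦ ?_⟩
        · exact (contMDiff_const.mul hφ :)
        · change c * φ p = 0
          rw [h₁ p hp, mul_zero] } with hΦ
  have hΦs : ∀ φ : Φ, ContMDiff (I.prod 𝓘(ℝ, ℝ)) 𝓘(ℝ, ℝ) ∞ (φ : M × ℝ → ℝ) := fun φ ↦ φ.2.1
  have hΦb : ∀ φ : Φ, ∀ x : M, ∀ s, b ≤ s → (φ : M × ℝ → ℝ) (x, s) = 0 := by
    intro φ x s hs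
    obtain ⟨b', hb', h'⟩ := φ.2.2
    exact h' (x, s) (hb'.le.trans hs)
  -- the linear maps into `L²(ν)`
  have hmemφ : ∀ φ : Φ, MemLp (φ : M × ℝ → ℝ) 2 ν := fun φ ↦ hmemS (hΦs φ).continuous
  have hmemA : ∀ φ : Φ, MemLp (A φ) 2 ν := fun φ ↦ hmemS (hAs (hΦs φ)).continuous
  set j : Φ →ₗ[ℝ] Lp ℝ 2 ν :=
    { toFun := fun φ ↦ (hmemφ φ).toLp (φ : M × ℝ → ℝ)
      map_add' := fun φ ψ ↦ MemLp.toLp_add (hmemφ φ) (hmemφ ψ)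
      map_smul' := fun c φ ↦ MemLp.toLp_const_smul c (hmemφ φ) } with hj
  have hAadd : ∀ φ ψ : Φ, A ((φ + ψ : Φ) : M × ℝ → ℝ) = A φ + A ψ := by
    intro φ ψ; funext p
    exact heatAdjoint_add hh hR hR₀ Q (hΦs φ) (hΦs ψ) p
  have hAsmul : ∀ (c : ℝ) (φ : Φ), A ((c • φ : Φ) : M × ℝ → ℝ) = c • A φ := by
    intro c φ; funext p
    exact heatAdjoint_smul hh hR hR₀ Q (hΦs φ) c p
  set K : Φ →ₗ[ℝ] Lp ℝ 2 ν :=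
    { toFun := fun φ ↦ (hmemA φ).toLp (A φ)
      map_add' := fun φ ψ ↦ by
        have h1 : (hmemA (φ + ψ)).toLp (A ((φ + ψ : Φ) : M × ℝ → ℝ)) =
            ((hmemA φ).add (hmemA ψ)).toLp (A φ + A ψ) :=
          MemLp.toLp_congr _ _ (Eventually.of_forall fun p ↦ by rw [hAadd])
        rw [h1]; exact MemLp.toLp_add (hmemA φ) (hmemA ψ)
      map_smul' := fun c φ ↦ by
        have h1 : (hmemA (c • φ)).toLp (A ((c • φ : Φ) : M × ℝ → ℝ)) =
            ((hmemA φ).const_smul c).toLp (c • A φ) :=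
          MemLp.toLp_congr _ _ (Eventually.of_forall fun p ↦ by rw [hAsmul])
        rw [h1]; exact MemLp.toLp_const_smul c (hmemA φ) } with hK
  set ℓ : Φ →ₗ[ℝ] ℝ :=
    { toFun := fun φ ↦ ∫ p, ρ p * G p.2 p.1 * (φ : M × ℝ → ℝ) p ∂ν
      map_add' := fun φ ψ ↦ by
        have hi : ∀ θ : Φ, Integrable (fun p ↦ ρ p * G p.2 p.1 * (θ : M × ℝ → ℝ) p) ν := fun θ ↦
          (hmemS ((hρs.continuous.mul hG.continuous).mul (hΦs θ).continuous)).integrable one_le_two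
        rw [← integral_add (hi φ) (hi ψ)]
        exact integral_congr_ae (Eventually.of_forall fun p ↦ by
          simp only [Submodule.coe_add, Pi.add_apply]; ring)
      map_smul' := fun c φ ↦ by
        rw [RingHom.id_apply, smul_eq_mul, ← MeasureTheory.integral_const_mul]
        exact integral_congr_ae (Eventually.of_forall fun p ↦ by
          simp only [Submodule.coe_smul, Pi.smul_apply, smul_eq_mul]; ring) } with hℓ
  -- the gauge and the constants
  set nΦ : Φ → ℝ := fun φ ↦ Real.sqrt (∫ p, ρ p * (φ : M × ℝ → ℝ) p ^ 2 ∂ν) with hnΦ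
  obtain ⟨ρm, hρm, hρmle⟩ : ∃ ρm : ℝ, 0 < ρm ∧ ∀ p ∈ univ ×ˢ Icc a b, ρm ≤ ρ p := by
    have hKc : IsCompact (univ ×ˢ Icc a b : Set (M × ℝ)) := isCompact_univ.prod isCompact_Icc
    rcases (univ ×ˢ Icc a b : Set (M × ℝ)).eq_empty_or_nonempty with he | hne
    · exact ⟨1, one_pos, fun p hp ↦ by rw [he] at hp; exact hp.elim⟩
    · obtain ⟨p₀, -, hmin⟩ := hKc.exists_isMinOn hne hρs.continuous.continuousOn
      exact ⟨ρ p₀, hρpos p₀, fun p hp ↦ hmin hp⟩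
  set C₀ : ℝ := 1 / Real.sqrt ρm with hC₀
  set C₁ : ℝ := Real.sqrt (∫ p, ρ p * G p.2 p.1 ^ 2 ∂ν) with hC₁
  have hmemν : ∀ᵐ p ∂ν, p ∈ S := by rw [hν]; exact ae_restrict_mem hSm
  -- (i) coercivity
  have hcoerc : ∀ φ : Φ, 1 * nΦ φ ^ 2 ≤ ⟪K φ, j φ⟫_ℝ := by
    intro φ
    have hint_eq : ⟪K φ, j φ⟫_ℝ = ∫ p, A φ p * (φ : M × ℝ → ℝ) p ∂ν :=
      inner_toLp_toLp_eq_integral (hmemA φ) (hmemφ φ)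
    rw [one_mul, hint_eq, hnΦ]
    dsimp only
    rw [Real.sq_sqrt (integral_nonneg fun p ↦ mul_nonneg (hρpos p).le (sq_nonneg _))]
    have hen := energy_le_integral_mul_heatAdjoint hh hR hR₀ hQ hab hcoer (hΦs φ) (hΦb φ)
    rw [hν]
    calc ∫ p in S, ρ p * (φ : M × ℝ → ℝ) p ^ 2 ∂μ₀.prod (volume : Measure ℝ)
        ≤ _ := hen
      _ = ∫ p in S, A φ p * (φ : M × ℝ → ℝ) p ∂μ₀.prod (volume : Measure ℝ) :=
          integral_congr_ae (Eventually.of_forall fun p ↦ by simp only [hA]; ring)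
  -- (ii) the inclusion is bounded
  have hemb : ∀ φ : Φ, ‖j φ‖ ≤ C₀ * nΦ φ := by
    intro φ
    change ‖(hmemφ φ).toLp (φ : M × ℝ → ℝ)‖ ≤ C₀ * nΦ φ
    rw [norm_toLp_two_eq_sqrt, hnΦ, hC₀]
    dsimp only
    rw [one_div, ← Real.sqrt_inv, ← Real.sqrt_mul (inv_nonneg.2 hρm.le)]
    refine Real.sqrt_le_sqrt ?_
    rw [← smul_eq_mul, ← MeasureTheory.integral_smul]
    refine integral_mono_ae ((hmemφ φ).integrable_sq) ?_ ?_
    · exact ((hmemS (hρs.continuous.mul ((hΦs φ).continuous.pow 2))).integrable one_le_two).smul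
        (ρm⁻¹ : ℝ)
    · filter_upwards [hmemν] with p hp
      have hρp : ρm ≤ ρ p := hρmle p ⟨mem_univ _, Ioo_subset_Icc_self hp.2⟩
      rw [smul_eq_mul]
      have hsq : 0 ≤ (φ : M × ℝ → ℝ) p ^ 2 := sq_nonneg _
      calc (φ : M × ℝ → ℝ) p ^ 2 = ρm⁻¹ * (ρm * (φ : M × ℝ → ℝ) p ^ 2) := by
            field_simp
        _ ≤ ρm⁻¹ * (ρ p * (φ : M × ℝ → ℝ) p ^ 2) := by gcongr
  -- (iii) the functional is bounded
  have hℓb : ∀ φ : Φ, |ℓ φ| ≤ C₁ * nΦ φ := by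
    intro φ
    change |∫ p, ρ p * G p.2 p.1 * (φ : M × ℝ → ℝ) p ∂ν| ≤ C₁ * nΦ φ
    exact abs_integral_weight_mul_le (fun p ↦ (hρpos p).le)
      (hmemS ((hρs.continuous.sqrt).mul hG.continuous))
      (hmemS ((hρs.continuous.sqrt).mul (hΦs φ).continuous))
  -- Lions' projection lemma
  obtain ⟨U, hU⟩ := lions_projection K j ℓ nΦ one_pos (by positivity) (Real.sqrt_nonneg _)
    (fun φ ↦ Real.sqrt_nonneg _) hcoerc hemb hℓb
  -- a measurable representative, extended by zero off the strip
  set Ut : M × ℝ → ℝ := (Lp.memLp U).1.mk U with hUt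
  have hUtm : Measurable Ut := (Lp.memLp U).1.stronglyMeasurable_mk.measurable
  have hUUt : (U : M × ℝ → ℝ) =ᵐ[ν] Ut := (Lp.memLp U).1.ae_eq_mk
  have hUt2 : MemLp Ut 2 ν := (Lp.memLp U).ae_eq hUUt
  set u : M × ℝ → ℝ := S.indicator Ut with hu
  refine ⟨u, hUtm.indicator hSm, ?_, ?_, ?_⟩
  · rw [hu, memLp_indicator_iff_restrict hSm]; exact hUt2
  · intro p hp
    rw [hu, indicator_of_notMem (fun h' : p ∈ S ↦ hp h'.2)]
  · intro ζ hζ hζc hζT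
    -- `ζ` belongs to the test space
    have hζΦ : ζ ∈ Φ := by
      refine ⟨hζ, ?_⟩
      set Kt : Set ℝ := Prod.snd '' tsupport ζ with hKt
      have hKtc : IsCompact Kt := hζc.image continuous_snd
      rcases Kt.eq_empty_or_nonempty with he | hne
      · refine ⟨b - 1, by linarith, fun p _ ↦ ?_⟩
        have : p ∉ tsupport ζ := fun h' ↦ by
          have : p.2 ∈ Kt := ⟨p, h', rfl⟩
          rw [he] at this; exact this
        exact image_eq_zero_of_notMem_tsupport this
      · obtain ⟨s₀, hs₀, hmax⟩ := hKtc.exists_isMaxOn hne continuous_id.continuousOn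
        obtain ⟨p₀, hp₀, rfl⟩ := hs₀
        have hs₀b : p₀.2 < b := (hζT hp₀).2
        refine ⟨(p₀.2 + b) / 2, by linarith, fun p hp ↦ ?_⟩
        have : p ∉ tsupport ζ := fun h' ↦ by
          have hle : p.2 ≤ p₀.2 := hmax ⟨p, h', rfl⟩
          linarith
        exact image_eq_zero_of_notMem_tsupport this
    have key := hU ⟨ζ, hζΦ⟩
    -- unfold both sides
    have hKζ : ⟪U, K ⟨ζ, hζΦ⟩⟫_ℝ = ∫ p, Ut p * A ζ p ∂ν := by
      have h1 : ⟪U, K ⟨ζ, hζΦ⟩⟫_ℝ = ⟪hUt2.toLp Ut, (hmemA ⟨ζ, hζΦ⟩).toLp (A ζ)⟫_ℝ := by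
        congr 1
        exact (Lp.toLp_coeFn U (Lp.memLp U)).symm.trans (MemLp.toLp_congr _ _ hUUt)
      rw [h1, inner_toLp_toLp_eq_integral]
    rw [hKζ] at key
    change ∫ p, Ut p * A ζ p ∂ν = ∫ p, ρ p * G p.2 p.1 * ζ p ∂ν at key
    rw [hν] at key
    have hlhs : ∫ p, u p * A ζ p ∂μ₀.prod (volume : Measure ℝ) =
        ∫ p in S, Ut p * A ζ p ∂μ₀.prod (volume : Measure ℝ) := by
      rw [← MeasureTheory.integral_indicator hSm]
      refine integral_congr_ae (Eventually.of_forall fun p ↦ ?_)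
      simp only [hu]
      by_cases hp : p ∈ S
      · rw [indicator_of_mem hp, indicator_of_mem hp]
      · rw [indicator_of_notMem hp, indicator_of_notMem hp, zero_mul]
    rw [hlhs]
    exact key

end Existence

/-! ### A smooth very weak solution is a classical solution -/

section Classical

variable [SecondCountableTopology M]
  (hh : IsContMDiffFamilyOn ∞ h univ) (hR : ∀ s, (h s).IsRiemannian)
  (hR₀ : g₀.IsRiemannian) {Q G : ℝ → M → ℝ}
  (hQ : ContMDiff (I.prod 𝓘(ℝ, ℝ)) 𝓘(ℝ, ℝ) ∞ fun p : M × ℝ ↦ Q p.2 p.1)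
  (hG : ContMDiff (I.prod 𝓘(ℝ, ℝ)) 𝓘(ℝ, ℝ) ∞ fun p : M × ℝ ↦ G p.2 p.1)

include hh hR hR₀ hQ hG in
/-- **A smooth very weak solution is a classical solution.** If `v` is `C^∞` on the open strip
`M × (a, b)` and `∫ v 𝒜ζ = ∫ ρ G ζ` for all smooth `ζ` compactly supported in the strip, then
`∂ₛv = Δ_{h(s)}v − Qv + G` at every point of the strip (cut `v` off in time to a smooth function
on `M × ℝ`, apply the space-time Green identity `integral_mul_heatAdjoint_eq`, the fundamental
lemma of the calculus of variations on the manifold `M × ℝ`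
(`IsOpen.ae_eq_zero_of_integral_contMDiff_smul_eq_zero`) and continuity).
[cite: Treves1975, §41, (41.20)–(41.21)] -/
theorem linearHeat_eq_of_smooth_veryWeak {a b : ℝ} {v : M × ℝ → ℝ}
    (hv : ContMDiffOn (I.prod 𝓘(ℝ, ℝ)) 𝓘(ℝ, ℝ) ∞ v (univ ×ˢ Ioo a b))
    (hweak : ∀ ζ : M × ℝ → ℝ, ContMDiff (I.prod 𝓘(ℝ, ℝ)) 𝓘(ℝ, ℝ) ∞ ζ → HasCompactSupport ζ →
      tsupport ζ ⊆ univ ×ˢ Ioo a b →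
      ∫ p, v p * (-(deriv (fun s ↦ (h s).densityRatio g₀ p.1 * ζ (p.1, s)) p.2) -
          (h p.2).densityRatio g₀ p.1 * (h p.2).laplaceBeltrami (fun x ↦ ζ (x, p.2)) p.1 +
          (h p.2).densityRatio g₀ p.1 * Q p.2 p.1 * ζ p) ∂g₀.riemVolume.prod (volume : Measure ℝ) =
        ∫ p, (h p.2).densityRatio g₀ p.1 * G p.2 p.1 * ζ p ∂g₀.riemVolume.prod (volume : Measure ℝ))
    {p₀ : M × ℝ} (hp₀ : p₀.2 ∈ Ioo a b) :
    deriv (fun s ↦ v (p₀.1, s)) p₀.2 =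
      (h p₀.2).laplaceBeltrami (fun x ↦ v (x, p₀.2)) p₀.1 - Q p₀.2 p₀.1 * v p₀ + G p₀.2 p₀.1 := by
  set μ₀ : Measure M := g₀.riemVolume with hμ₀
  haveI : IsFiniteMeasure μ₀ := by
    rw [hμ₀, riemVolume_eq hR₀]; exact isFiniteMeasure_riemannianMeasure _
  haveI : μ₀.IsOpenPosMeasure := by
    rw [hμ₀, riemVolume_eq hR₀]; exact isOpenPosMeasure_riemannianMeasure _
  haveI : (μ₀.prod (volume : Measure ℝ)).IsOpenPosMeasure := prod.instIsOpenPosMeasure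
  set ρ : M × ℝ → ℝ := fun p ↦ (h p.2).densityRatio g₀ p.1 with hρ
  have hρs : ContMDiff (I.prod 𝓘(ℝ, ℝ)) 𝓘(ℝ, ℝ) ∞ ρ := contMDiff_densityRatio_family hh hR hR₀
  have hρpos : ∀ p, 0 < ρ p := fun p ↦ densityRatio_pos (hR p.2) hR₀ p.1
  obtain ⟨x₀, s₀⟩ := p₀
  obtain ⟨hs₀a, hs₀b⟩ := hp₀
  -- a smaller time window and a time cutoff
  set a₁ : ℝ := (a + s₀) / 2 with ha₁
  set b₁ : ℝ := (s₀ + b) / 2 with hb₁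
  have ha₁' : a < a₁ := by rw [ha₁]; linarith
  have hb₁' : b₁ < b := by rw [hb₁]; linarith
  have hs₀₁ : s₀ ∈ Ioo a₁ b₁ := ⟨by rw [ha₁]; linarith, by rw [hb₁]; linarith⟩
  set c : ℝ := (a₁ + b₁) / 2 with hc
  set rIn : ℝ := (b₁ - a₁) / 2 with hrIn
  set δ : ℝ := min (a₁ - a) (b - b₁) / 2 with hδ
  have hδ0 : 0 < δ := by rw [hδ]; have := lt_min (sub_pos.2 ha₁') (sub_pos.2 hb₁'); linarith
  have hrIn0 : 0 < rIn := by rw [hrIn]; linarith [hs₀₁.1, hs₀₁.2]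
  let χ : ContDiffBump c := ⟨rIn, rIn + δ, hrIn0, by linarith⟩
  have hχ1 : ∀ s ∈ Icc a₁ b₁, χ s = 1 := fun s hs ↦ χ.one_of_mem_closedBall (by
    rw [Metric.mem_closedBall, Real.dist_eq, abs_le]; constructor <;>
      · simp only [hc]; linarith [hs.1, hs.2])
  have hχsupp : ∀ s, χ s ≠ 0 → s ∈ Ioo a b := by
    intro s hs
    have hs' : s ∈ Metric.ball c (rIn + δ) := by
      by_contra h'
      exact hs (χ.zero_of_le_dist (not_lt.1 (by rwa [Metric.mem_ball] at h')))
    rw [Metric.mem_ball, Real.dist_eq, abs_lt] at hs'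
    have hδ1 : δ ≤ (a₁ - a) / 2 := by rw [hδ]; linarith [min_le_left (a₁ - a) (b - b₁)]
    have hδ2 : δ ≤ (b - b₁) / 2 := by rw [hδ]; linarith [min_le_right (a₁ - a) (b - b₁)]
    simp only [hc, hrIn] at hs'
    constructor <;> linarith [hs'.1, hs'.2]
  -- the cut-off function `v' = χ(s) v`, smooth on `M × ℝ`
  set v' : M × ℝ → ℝ := fun p ↦ χ p.2 * v p with hv'
  have hχs : ContMDiff (I.prod 𝓘(ℝ, ℝ)) 𝓘(ℝ, ℝ) ∞ fun p : M × ℝ ↦ (χ : ℝ → ℝ) p.2 :=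
    χ.contDiff.contMDiff.comp contMDiff_snd
  have hv's : ContMDiff (I.prod 𝓘(ℝ, ℝ)) 𝓘(ℝ, ℝ) ∞ v' := by
    intro p
    by_cases hp : p.2 ∈ Ioo a b
    · have hO : IsOpen (univ ×ˢ Ioo a b : Set (M × ℝ)) := isOpen_univ.prod isOpen_Ioo
      exact (hχs p).mul (hv.contMDiffAt (hO.mem_nhds ⟨mem_univ _, hp⟩))
    · -- near `p` the cut-off vanishes
      have hK : IsCompact (tsupport (χ : ℝ → ℝ)) := χ.hasCompactSupport
      have hpK : p.2 ∉ tsupport (χ : ℝ → ℝ) := by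
        intro h'
        rw [χ.tsupport_eq, Metric.mem_closedBall] at h'
        have : p.2 ∈ Ioo a b := by
          have hδ1 : δ ≤ (a₁ - a) / 2 := by rw [hδ]; linarith [min_le_left (a₁ - a) (b - b₁)]
          have hδ2 : δ ≤ (b - b₁) / 2 := by rw [hδ]; linarith [min_le_right (a₁ - a) (b - b₁)]
          rw [Real.dist_eq, abs_le] at h'
          simp only [hc] at h'
          constructor <;> linarith [h'.1, h'.2]
        exact hp this
      have hev : v' =ᶠ[𝓝 p] fun _ ↦ 0 := by
        have hopen : IsOpen ((tsupport (χ : ℝ → ℝ))ᶜ) := (isClosed_tsupport _).isOpen_compl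
        have : ∀ᶠ q in 𝓝 p, q.2 ∈ (tsupport (χ : ℝ → ℝ))ᶜ :=
          continuous_snd.continuousAt.eventually (hopen.mem_nhds hpK)
        filter_upwards [this] with q hq
        simp only [hv', image_eq_zero_of_notMem_tsupport hq, zero_mul]
      exact contMDiffAt_const.congr_of_eventuallyEq hev
  -- the weak identity transfers to `v'` for test functions supported in the smaller window
  set U : Set (M × ℝ) := univ ×ˢ Ioo a₁ b₁ with hU
  have hUo : IsOpen U := isOpen_univ.prod isOpen_Ioo
  have hUsub : U ⊆ univ ×ˢ Ioo a b := prod_mono le_rfl (Ioo_subset_Ioo ha₁'.le hb₁'.le)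
  set f : M × ℝ → ℝ := fun p ↦ ρ p * (deriv (fun s ↦ v' (p.1, s)) p.2 -
      (h p.2).laplaceBeltrami (fun x ↦ v' (x, p.2)) p.1 + Q p.2 p.1 * v' p) -
      ρ p * G p.2 p.1 with hf
  have hfs : ContMDiff (I.prod 𝓘(ℝ, ℝ)) 𝓘(ℝ, ℝ) ∞ f :=
    (hρs.mul (((contMDiff_deriv_time hv's).sub (contMDiff_laplaceBeltrami_family hh hv's)).add
      (hQ.mul hv's))).sub (hρs.mul hG)
  have hzero : ∀ ζ : M × ℝ → ℝ, ContMDiff (I.prod 𝓘(ℝ, ℝ)) 𝓘(ℝ, ℝ) ∞ ζ → HasCompactSupport ζ →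
      tsupport ζ ⊆ U → ∫ p, ζ p • f p ∂μ₀.prod (volume : Measure ℝ) = 0 := by
    intro ζ hζ hζc hζU
    have hGreen := integral_mul_heatAdjoint_eq hh hR hR₀ hQ hv's hζ hζc
    -- `v' = v` on the support of `𝒜ζ`
    have hvv' : ∫ p, v' p * (-(deriv (fun s ↦ (h s).densityRatio g₀ p.1 * ζ (p.1, s)) p.2) -
        (h p.2).densityRatio g₀ p.1 * (h p.2).laplaceBeltrami (fun x ↦ ζ (x, p.2)) p.1 +
        (h p.2).densityRatio g₀ p.1 * Q p.2 p.1 * ζ p) ∂μ₀.prod (volume : Measure ℝ) =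
        ∫ p, v p * (-(deriv (fun s ↦ (h s).densityRatio g₀ p.1 * ζ (p.1, s)) p.2) -
        (h p.2).densityRatio g₀ p.1 * (h p.2).laplaceBeltrami (fun x ↦ ζ (x, p.2)) p.1 +
        (h p.2).densityRatio g₀ p.1 * Q p.2 p.1 * ζ p) ∂μ₀.prod (volume : Measure ℝ) := by
      refine integral_congr_ae (Eventually.of_forall fun p ↦ ?_)
      by_cases hp : p ∈ tsupport ζ
      · have hp2 : p.2 ∈ Icc a₁ b₁ := Ioo_subset_Icc_self (hζU hp).2
        simp only [hv', hχ1 p.2 hp2, one_mul]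
      · simp only [heatAdjoint_eq_zero_of_notMem_tsupport hp, mul_zero]
    rw [hvv', hweak ζ hζ hζc (hζU.trans hUsub)] at hGreen
    -- `∫ ρ G ζ = ∫ ρ (∂v' − Δv' + Qv') ζ`
    have hi1 : Integrable (fun p ↦ ρ p * (deriv (fun s ↦ v' (p.1, s)) p.2 -
        (h p.2).laplaceBeltrami (fun x ↦ v' (x, p.2)) p.1 + Q p.2 p.1 * v' p) * ζ p)
        (μ₀.prod (volume : Measure ℝ)) :=
      ((hρs.mul (((contMDiff_deriv_time hv's).sub (contMDiff_laplaceBeltrami_family hh hv's)).add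
        (hQ.mul hv's))).mul hζ).continuous.integrable_of_hasCompactSupport hζc.mul_left
    have hi2 : Integrable (fun p ↦ ρ p * G p.2 p.1 * ζ p) (μ₀.prod (volume : Measure ℝ)) :=
      ((hρs.mul hG).mul hζ).continuous.integrable_of_hasCompactSupport hζc.mul_left
    calc ∫ p, ζ p • f p ∂μ₀.prod (volume : Measure ℝ)
        = ∫ p, (ρ p * (deriv (fun s ↦ v' (p.1, s)) p.2 -
            (h p.2).laplaceBeltrami (fun x ↦ v' (x, p.2)) p.1 + Q p.2 p.1 * v' p) * ζ p -
            ρ p * G p.2 p.1 * ζ p) ∂μ₀.prod (volume : Measure ℝ) :=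
          integral_congr_ae (Eventually.of_forall fun p ↦ by simp only [hf, smul_eq_mul]; ring)
      _ = 0 := by rw [integral_sub hi1 hi2, ← hGreen]; simp only [hρ]; ring
  -- fundamental lemma of the calculus of variations on `M × ℝ`
  have hae : ∀ᵐ p ∂μ₀.prod (volume : Measure ℝ), p ∈ U → f p = 0 :=
    hUo.ae_eq_zero_of_integral_contMDiff_smul_eq_zero (I.prod 𝓘(ℝ, ℝ))
      (hfs.continuous.locallyIntegrable.locallyIntegrableOn U) hzero
  have hfU : EqOn f 0 U := by
    refine Measure.eqOn_open_of_ae_eq (μ := μ₀.prod (volume : Measure ℝ)) ?_ hUo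
      hfs.continuous.continuousOn continuousOn_const
    rw [Filter.EventuallyEq, ae_restrict_iff' hUo.measurableSet]
    filter_upwards [hae] with p hp hpU using hp hpU
  have hf0 := hfU (show ((x₀, s₀) : M × ℝ) ∈ U from ⟨mem_univ _, hs₀₁⟩)
  simp only [hf, Pi.zero_apply] at hf0
  -- `v' = v` near `(x₀, s₀)`
  have hχev : ∀ᶠ s in 𝓝 s₀, (χ : ℝ → ℝ) s = 1 := by
    filter_upwards [isOpen_Ioo.mem_nhds hs₀₁] with s hs using hχ1 s (Ioo_subset_Icc_self hs)
  have hd : deriv (fun s ↦ v' (x₀, s)) s₀ = deriv (fun s ↦ v (x₀, s)) s₀ := by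
    refine Filter.EventuallyEq.deriv_eq ?_
    filter_upwards [hχev] with s hs
    simp only [hv', hs, one_mul]
  have hΔ : (h s₀).laplaceBeltrami (fun x ↦ v' (x, s₀)) x₀ =
      (h s₀).laplaceBeltrami (fun x ↦ v (x, s₀)) x₀ := by
    have : (fun x ↦ v' (x, s₀)) = fun x ↦ v (x, s₀) := by
      funext x; simp only [hv', hχ1 s₀ (Ioo_subset_Icc_self hs₀₁), one_mul]
    rw [this]
  have hv0 : v' (x₀, s₀) = v (x₀, s₀) := by
    simp only [hv', hχ1 s₀ (Ioo_subset_Icc_self hs₀₁), one_mul]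
  rw [hd, hΔ, hv0] at hf0
  have hρ0 : ρ (x₀, s₀) ≠ 0 := (hρpos _).ne'
  have : deriv (fun s ↦ v (x₀, s)) s₀ - (h s₀).laplaceBeltrami (fun x ↦ v (x, s₀)) x₀ +
      Q s₀ x₀ * v (x₀, s₀) - G s₀ x₀ = 0 := by
    have h1 : ρ (x₀, s₀) * (deriv (fun s ↦ v (x₀, s)) s₀ -
        (h s₀).laplaceBeltrami (fun x ↦ v (x, s₀)) x₀ + Q s₀ x₀ * v (x₀, s₀) - G s₀ x₀) = 0 := by
      simp only [hρ] at hf0 ⊢; linarith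
    exact (mul_eq_zero.1 h1).resolve_left hρ0
  dsimp only
  linarith

end Classical

end Literature.Geometry.Riemannian
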